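import Literature.Analysis.FluidPDE.NovackBallAvgBalance
import Literature.Analysis.FluidPDE.DuchonRobertCubicIdentity
import Literature.Analysis.FluidPDE.DuchonRobertLocalBalancePressureProofs
import Literature.Analysis.FluidPDE.EyinkUniformDefect
import Literature.Analysis.FluidPDE.DuchonRobertSymmTestFieldProofs
import Literature.Analysis.FluidPDE.NovackKernelFamily
import HarnessLib

/-!
# Novack's ball-averaged energy balance at scale `ℓ`: the passage to the ball kernel (proofs)

Proof file for `Literature.Analysis.FluidPDE.NovackBallAvgBalance` (M. Novack, *Scaling laws and
exact results in turbulence*, Nonlinearity 37 (2024) 095002, Thm. 1, line `• = I`; §2 Step 1).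
It **proves the named fact `Torus.novack2024_ballAvg_balance`** (`novack2024_ballAvg_balance_holds`)
— the scale-`ℓ` balance (eq:main:balance) with the ball kernel (`γ = 0`),
`𝒩_ℓ(ψ) = −(d/ℓ) ∫₀ᵀ∫ ⨍_{S^{d−1}} (δu·ω)|δu|²(ℓω) dω ψ` — through the reduction
`novack2024_ballAvg_balance_of_symmTestField_identity` to Duchon–Robert's tested momentum equation
"(NS)·u^ε + (NS^ε)·u" (`Torus.IsDistributionalNSSolutionOn.symmTestField_identity`, Novack's
(eq:1) + (eq:2) of Step 0), which the tree discharges in `DuchonRobertSymmTestFieldProofs`.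

## The printed proof and its transcription

Novack runs Duchon–Robert's computation with radial kernels `Φ_{ℓ,γ}` (smooth for `γ > 0`, "we do
not necessarily assume that `Φ_{ℓ,γ}` integrates to `1`"), obtaining (eq:main:balance) for
`γ > 0`, and then lets `γ → 0`: "We first pass to the limit in every term from (last:one) except the
very last term …, using the integrability assumptions on all involved quantities and the dominated
convergence theorem", while in (DR) "changing to spherical variables `y ↦ (r,σ)` … we use
(dumber:bound) [Appendix, Prop. 1] to pass to the limit", giving
`D_{I,ℓ,0} = −(d/(4ℓ))⨍ y·δu|δu|²(ℓy)`.

Transcription on `T^d`, with **the tree's kernel family at fixed scale `ℓ`**: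
`K_m = mollifierKernel (plateauMollifier d m) ℓ` (`DuchonRobertUniformDefect`: the unit-mass radial
plateau mollifiers `φ_m = ρ_m/∫ρ_m`, `ρ_m(ξ) = S(m(1 − |ξ|))`, rescaled by Duchon–Robert's
`φ ↦ ℓ^{-d}φ(·/ℓ)` and periodised — a legal instance of Novack's `Φ_{ℓ,γ}`, collar width `γ = 1/m`),
along `m = k + 2 → ∞`:

* **(eq:main:balance), `γ > 0`** (`novackKernelPairing_eq_integral_kernelFlux`): with Novack's
  pairing `𝒩[K](ψ)` (`novackKernelPairing`: `novackBallPairing` with `f^ℓ ↦ f ⋆ K`), for every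
  smooth even kernel `K`, `𝒩[K](ψ) = ∫₀ᵀ∫ 𝒟_K(u)ψ` — the cubic identity
  (`Torus.integral_kernelFlux_mul_eq_holds`), the tested equation, and the pressure pairing of the
  symmetric field split as `∫∫ p div Φ = ∫∫ p⟪u⋆K,∇ψ⟫ + ∫∫ (p⋆K)⟪u,∇ψ⟫`
  (`integral_pressure_divergence_symmTestField_eq`).
* **`γ → 0` on the left** (`tendsto_novackKernelPairing_mollifierKernel`): the rescaled plateau
  mollifiers are uniformly bounded and converge *at every point* to the ball kernel
  `|B_ℓ|⁻¹ 1_{B_ℓ}` (`tendsto_mollifierScale_plateauMollifier`; on the sphere `|ξ| = ℓ` both vanish),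
  hence `f ⋆ K_m → f^ℓ = ⨍_{B_ℓ} f(· + y) dy` pointwise for integrable slices
  (`integral_ballTorusKernel_smul_translate`, `tendsto_vecConv_mollifierKernel`), and the six
  pairings converge by dominated convergence on `(0,T) × T^d` with the slice-norm dominations
  `(∫|u(t)|)|u|`, `(∫|u(t)|)|u|²`, `∫|u(t)|³`, `(∫|u(t)|²)|u|`, `|p|∫|u(t)|`, `(∫|p(t)|)|u|`.
* **`γ → 0` on the right** (`tendsto_integral_kernelFlux_mollifierKernel`), entirely from the tree
  (`DuchonRobertUniformDefect`, the block `hA`/`hJ` of `HasUniformDuchonRobertDefect.hasFourThirdsLaw`):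
  `𝒟_{K_m} = 4D_ℓ^{φ_m}` slice-wise (`four_mul_duchonRobertApprox_eq_kernelFlux`), the radial form of
  the Duchon–Robert pairing (`integral_duchonRobertApprox_eq_radial`), the un-averaging lemma at fixed
  scale (`tendsto_integral_pow_mul_deriv_profile_mul`) applied to the shell function
  `r⁻¹ I(r)`, continuous on `(0,∞)` by `continuous_shellPairing` (the content of Novack's Appendix,
  Prop. 1), and `integral_inv_mul_energyFluxSphereAvg_eq`.
* **Assembly**: the two limits along `atTop` of the two sides of the `γ > 0` balance coincide.

## Design notes

* The left-hand limit is taken by pointwise dominated convergence rather than through the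
  `L^q`-kernel-average engine `Torus.tendsto_integral_mul_kernelAverage_of_conj/_of_bound` of the
  sibling `NovackKernelAverages` (written for scalar fields and weights): the six pairings here are
  inner products of vector-valued mollifications, and the kernels converge at every point, so the
  vector-valued pointwise route avoids a componentwise decomposition; the bridge
  `integral_ballTorusKernel_smul_translate` is the vector-valued, *indicator*-kernel companion of
  `Torus.convolution_periodize_apply` (which assumes a continuous kernel).
* Proof-internal definitions: `ballIndicatorKernel`, `ballTorusKernel` (the limit kernel and its
  periodisation), `novackKernelPairing`.

## References

* M. Novack, *Scaling laws and exact results in turbulence*, Nonlinearity 37 (2024) 095002,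
  doi:10.1088/1361-6544/ad6057, arXiv:2310.01375 (held): §2 (kernels (mollies), Step 0, Step 1:
  (eq:main:balance), (eq:adding), (firstD), (DR), (last:one), the limit `γ → 0`), Appendix Prop. 1.
  Equation labels are the `\label`s of the arXiv source. [Novack2024]
* J. Duchon, R. Robert, Nonlinearity 13 (2000) 249–255, proof of Prop. 1 pp. 250–251. [DuchonRobert2000]

## Mathlib / tree

Mathlib (this pin): `Measure.addHaar_ball`, `tendsto_integral_of_dominated_convergence`; no
ball-average / structure-function API. Tree: `DuchonRobertUniformDefect` (the plateau family and
the whole right-hand limit, see above), `EyinkUniformDefect` (`tendsto_integral_plateauBump`), `DuchonRobertLocalBalance` (`mollifierKernel`,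
`isSmooth_mollifierKernel`, `mollifierKernel_neg`, `four_mul_duchonRobertApprox_eq_kernelFlux`),
`DuchonRobertCubicIdentity` (`integral_kernelFlux_mul_eq_holds`, slice dominations),
`DuchonRobertLocalBalancePressureProofs` (`divergence_symmTestField`, Hölder glue),
`DuchonRobertSymmTestFieldProofs` (`symmTestField_identity_holds`), `NovackKernelFamily`
(`periodize_neg_of_even`), `TorusPeriodization`, `TorusSpaceTimeConvolution`
(`integral_mul_convolution_comm`), `NovackBallAvgLimitProofs` (the sibling `ℓ → 0` limit).
-/

noncomputable section

open MeasureTheory TopologicalSpace Set Function Filter Metric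
open _root_.Topology
open scoped InnerProductSpace RealInnerProductSpace ENNReal NNReal Convolution BoundedContinuousFunction

namespace Literature.Analysis.FluidPDE.Torus

section PartA


variable {d : Type*} [Fintype d] [DecidableEq d]

/-! ## Slice-norm dominations for the pressure pairings -/

section Domination

variable {T : ℝ} {u : ℝ → UnitAddTorus d → EuclideanSpace ℝ d} {p : ℝ → UnitAddTorus d → ℝ}

omit [DecidableEq d] in
/-- Jensen on the probability space `T^d`, lower-integral form: `(∫⁻ ‖f‖)^r ≤ ∫⁻ ‖f‖^r` for
`r ≥ 1`. [folklore] -/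
theorem lintegral_enorm_rpow_le {F : Type*} [NormedAddCommGroup F] {f : UnitAddTorus d → F}
    (hf : AEStronglyMeasurable f volume) {r : ℝ} (hr : 1 ≤ r) :
    (∫⁻ y, ‖f y‖ₑ) ^ r ≤ ∫⁻ y, ‖f y‖ₑ ^ r := by
  have hr0 : 0 < r := by linarith
  have hre : ENNReal.ofReal r ≠ 0 := by simpa using hr0
  have h1 : eLpNorm f 1 volume ≤ eLpNorm f (ENNReal.ofReal r) volume :=
    eLpNorm_le_eLpNorm_of_exponent_le (by simpa using ENNReal.ofReal_le_ofReal hr) hf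
  rw [eLpNorm_one_eq_lintegral_enorm,
    eLpNorm_eq_lintegral_rpow_enorm_toReal hre ENNReal.ofReal_ne_top,
    ENNReal.toReal_ofReal hr0.le] at h1
  have h2 := ENNReal.rpow_le_rpow h1 hr0.le
  rwa [← ENNReal.rpow_mul, one_div, inv_mul_cancel₀ hr0.ne', ENNReal.rpow_one] at h2

omit [DecidableEq d] in
/-- **The pressure–velocity slice domination** on `(0,T) × T^d`: for `u ∈ L³_{t,x}`,
`p ∈ L^{3/2}_{t,x}`, `(t,x) ↦ |p(t,x)| ∫|u(t)|` is integrable (Hölder `3/2, 3` after Jensen in the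
slice). [folklore] -/
theorem integrable_pressure_mul_sliceNorm
    (hum : AEStronglyMeasurable (uncurry u) ((volume.restrict (Ioo 0 T)).prod volume))
    (hu3 : ∫⁻ t in Ioo 0 T, ∫⁻ x, ‖u t x‖ₑ ^ 3 < ⊤)
    (hpm : AEStronglyMeasurable (uncurry p) ((volume.restrict (Ioo 0 T)).prod volume))
    (hp : ∫⁻ t in Ioo 0 T, ∫⁻ x, ‖p t x‖ₑ ^ (3 / 2 : ℝ) < ⊤) :
    Integrable (fun z : ℝ × UnitAddTorus d => ‖p z.1 z.2‖ * ∫ y, ‖u z.1 y‖)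
      ((volume.restrict (Ioo 0 T)).prod volume) := by
  set μ : Measure ℝ := volume.restrict (Ioo 0 T) with hμ
  set μT := μ.prod (volume : Measure (UnitAddTorus d)) with hμT
  have hN : AEStronglyMeasurable (fun t => ∫ y, ‖u t y‖) μ := hum.norm.integral_prod_right'
  have hNm : AEStronglyMeasurable (fun z : ℝ × UnitAddTorus d => ∫ y, ‖u z.1 y‖) μT := hN.comp_fst
  have hP32 : ∫⁻ z, ‖‖p z.1 z.2‖‖ₑ ^ (3 / 2 : ℝ) ∂μT < ⊤ := by
    have e : ∫⁻ t in Ioo 0 T, ∫⁻ x, ‖p t x‖ₑ ^ (3 / 2 : ℝ) = ∫⁻ z, ‖p z.1 z.2‖ₑ ^ (3 / 2 : ℝ) ∂μT :=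
      lintegral_Ioo_lintegral_eq_lintegral_prod (hpm.enorm.pow_const _)
    simp only [enorm_norm]
    rwa [← e]
  have hslice : ∀ᵐ t ∂μ, AEStronglyMeasurable (u t) volume := hum.prodMk_left
  have hN3 : ∫⁻ z, ‖∫ y, ‖u z.1 y‖‖ₑ ^ (3 : ℝ) ∂μT < ⊤ := by
    have hmeas : AEMeasurable (fun z : ℝ × UnitAddTorus d => ‖∫ y, ‖u z.1 y‖‖ₑ ^ (3 : ℝ)) μT :=
      hNm.enorm.pow_const _
    calc ∫⁻ z, ‖∫ y, ‖u z.1 y‖‖ₑ ^ (3 : ℝ) ∂μT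
        = ∫⁻ t, (∫⁻ _x : UnitAddTorus d, ‖∫ y, ‖u t y‖‖ₑ ^ (3 : ℝ)) ∂μ := by
          rw [lintegral_prod _ hmeas]
      _ = ∫⁻ t, ‖∫ y, ‖u t y‖‖ₑ ^ (3 : ℝ) ∂μ := by
          refine lintegral_congr fun t => ?_
          rw [lintegral_const, measure_univ, mul_one]
      _ ≤ ∫⁻ t, (∫⁻ x, ‖u t x‖ₑ ^ 3) ∂μ := by
          refine lintegral_mono_ae (hslice.mono fun t ht => ?_)
          have h1 : ‖∫ y, ‖u t y‖‖ₑ ≤ ∫⁻ y, ‖u t y‖ₑ :=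
            (enorm_integral_le_lintegral_enorm _).trans (le_of_eq (lintegral_congr fun y => enorm_norm _))
          calc ‖∫ y, ‖u t y‖‖ₑ ^ (3 : ℝ) ≤ (∫⁻ y, ‖u t y‖ₑ) ^ (3 : ℝ) := ENNReal.rpow_le_rpow h1 (by norm_num)
            _ ≤ ∫⁻ y, ‖u t y‖ₑ ^ (3 : ℝ) := lintegral_enorm_rpow_le ht (by norm_num)
            _ = ∫⁻ y, ‖u t y‖ₑ ^ 3 := by
                refine lintegral_congr fun y => ?_
                rw [← ENNReal.rpow_natCast]; norm_num
      _ < ⊤ := hu3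
  exact integrable_mul_of_lintegral_rpow hpm.norm hNm hP32 hN3

omit [DecidableEq d] in
/-- **The velocity–pressure slice domination** on `(0,T) × T^d`: for `u ∈ L³_{t,x}`,
`p ∈ L^{3/2}_{t,x}`, `(t,x) ↦ (∫|p(t)|) |u(t,x)|` is integrable. [folklore] -/
theorem integrable_sliceNorm_pressure_mul
    (hum : AEStronglyMeasurable (uncurry u) ((volume.restrict (Ioo 0 T)).prod volume))
    (hu3 : ∫⁻ t in Ioo 0 T, ∫⁻ x, ‖u t x‖ₑ ^ 3 < ⊤)
    (hpm : AEStronglyMeasurable (uncurry p) ((volume.restrict (Ioo 0 T)).prod volume))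
    (hp : ∫⁻ t in Ioo 0 T, ∫⁻ x, ‖p t x‖ₑ ^ (3 / 2 : ℝ) < ⊤) :
    Integrable (fun z : ℝ × UnitAddTorus d => (∫ y, ‖p z.1 y‖) * ‖u z.1 z.2‖)
      ((volume.restrict (Ioo 0 T)).prod volume) := by
  set μ : Measure ℝ := volume.restrict (Ioo 0 T) with hμ
  set μT := μ.prod (volume : Measure (UnitAddTorus d)) with hμT
  have hN : AEStronglyMeasurable (fun t => ∫ y, ‖p t y‖) μ := hpm.norm.integral_prod_right'
  have hNm : AEStronglyMeasurable (fun z : ℝ × UnitAddTorus d => ∫ y, ‖p z.1 y‖) μT := hN.comp_fst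
  have hU3 : ∫⁻ z, ‖‖u z.1 z.2‖‖ₑ ^ (3 : ℝ) ∂μT < ⊤ := by
    have e : ∫⁻ t in Ioo 0 T, ∫⁻ x, ‖u t x‖ₑ ^ (3 : ℝ) = ∫⁻ z, ‖u z.1 z.2‖ₑ ^ (3 : ℝ) ∂μT :=
      lintegral_Ioo_lintegral_eq_lintegral_prod (hum.enorm.pow_const _)
    simp only [enorm_norm]
    rw [← e]
    simpa only [ENNReal.rpow_ofNat] using hu3
  have hslice : ∀ᵐ t ∂μ, AEStronglyMeasurable (p t) volume := hpm.prodMk_left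
  have hN32 : ∫⁻ z, ‖∫ y, ‖p z.1 y‖‖ₑ ^ (3 / 2 : ℝ) ∂μT < ⊤ := by
    have hmeas : AEMeasurable (fun z : ℝ × UnitAddTorus d => ‖∫ y, ‖p z.1 y‖‖ₑ ^ (3 / 2 : ℝ)) μT :=
      hNm.enorm.pow_const _
    calc ∫⁻ z, ‖∫ y, ‖p z.1 y‖‖ₑ ^ (3 / 2 : ℝ) ∂μT
        = ∫⁻ t, (∫⁻ _x : UnitAddTorus d, ‖∫ y, ‖p t y‖‖ₑ ^ (3 / 2 : ℝ)) ∂μ := by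
          rw [lintegral_prod _ hmeas]
      _ = ∫⁻ t, ‖∫ y, ‖p t y‖‖ₑ ^ (3 / 2 : ℝ) ∂μ := by
          refine lintegral_congr fun t => ?_
          rw [lintegral_const, measure_univ, mul_one]
      _ ≤ ∫⁻ t, (∫⁻ x, ‖p t x‖ₑ ^ (3 / 2 : ℝ)) ∂μ := by
          refine lintegral_mono_ae (hslice.mono fun t ht => ?_)
          have h1 : ‖∫ y, ‖p t y‖‖ₑ ≤ ∫⁻ y, ‖p t y‖ₑ :=
            (enorm_integral_le_lintegral_enorm _).trans (le_of_eq (lintegral_congr fun y => enorm_norm _))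
          calc ‖∫ y, ‖p t y‖‖ₑ ^ (3 / 2 : ℝ) ≤ (∫⁻ y, ‖p t y‖ₑ) ^ (3 / 2 : ℝ) :=
                ENNReal.rpow_le_rpow h1 (by norm_num)
            _ ≤ ∫⁻ y, ‖p t y‖ₑ ^ (3 / 2 : ℝ) := lintegral_enorm_rpow_le ht (by norm_num)
      _ < ⊤ := hp
  have h := integrable_mul_of_lintegral_rpow hNm hum.norm hN32 hU3
  exact h

end Domination

/-! ## Novack's scale pairing through a smooth kernel, and the smooth-kernel balance -/

section KernelBalance

variable {T : ℝ} {u : ℝ → UnitAddTorus d → EuclideanSpace ℝ d} {p : ℝ → UnitAddTorus d → ℝ}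
  {K : UnitAddTorus d → ℝ} {ψ : ℝ → UnitAddTorus d → ℝ}

omit [DecidableEq d] in
/-- **Novack's scale pairing through a torus kernel `K`**: the pairing `𝒩_ℓ(ψ)`
(`Torus.novackBallPairing`) with every ball average `f^ℓ` replaced by the mollification `f ⋆ K`
(`Torus.vecConv` for vector fields) — twice the left-hand side of Novack's balance
(eq:main:balance) for a general (smooth, radial) kernel `Φ_{ℓ,γ}`, `γ > 0`, tested against `ψ`:
`𝒩[K](ψ) = 2∫∫⟪u,u⋆K⟫∂ₜψ + 2∫∫⟪u,u⋆K⟫⟪u,∇ψ⟫ + ∫∫⟪(|u|²u)⋆K,∇ψ⟫ − ∫∫(|u|²⋆K)⟪u,∇ψ⟫ + 2∫∫p⟪u⋆K,∇ψ⟫ + 2∫∫(p⋆K)⟪u,∇ψ⟫`. [cite: Novack2024, Sect. 2 Step 1 (eq:main:balance) with γ > 0] -/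
def novackKernelPairing (T : ℝ) (u : ℝ → UnitAddTorus d → EuclideanSpace ℝ d)
    (p : ℝ → UnitAddTorus d → ℝ) (ψ : ℝ → UnitAddTorus d → ℝ) (K : UnitAddTorus d → ℝ) : ℝ :=
  2 * (∫ t in Ioo 0 T, ∫ x, ⟪u t x, vecConv (u t) K x⟫ * FunctionSpaces.Torus.timeDeriv ψ t x) +
    2 * (∫ t in Ioo 0 T, ∫ x,
      ⟪u t x, vecConv (u t) K x⟫ * ⟪u t x, FunctionSpaces.Torus.gradient (ψ t) x⟫) +
    (∫ t in Ioo 0 T, ∫ x,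
      ⟪vecConv (fun y => ‖u t y‖ ^ 2 • u t y) K x, FunctionSpaces.Torus.gradient (ψ t) x⟫) -
    (∫ t in Ioo 0 T, ∫ x,
      ((fun y => ‖u t y‖ ^ 2) ⋆ K) x * ⟪u t x, FunctionSpaces.Torus.gradient (ψ t) x⟫) +
    2 * (∫ t in Ioo 0 T, ∫ x, p t x * ⟪vecConv (u t) K x, FunctionSpaces.Torus.gradient (ψ t) x⟫) +
    2 * (∫ t in Ioo 0 T, ∫ x, (p t ⋆ K) x * ⟪u t x, FunctionSpaces.Torus.gradient (ψ t) x⟫)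

/-- **The pressure pairing of the symmetric field, split** (Novack 2024, §2 Step 1, the pressure
terms of (last:one): `∂ⁱ(p u^ℓᵢ + p^ℓ uᵢ)`; Duchon–Robert 2000, proof of Prop. 1, p. 251,
`div(½(u p^ε + u^ε p))`): for `u ∈ L³_{t,x}` weakly divergence free at a.e. time,
`p ∈ L^{3/2}_{t,x}`, a smooth even kernel `K` and a test function `ψ` supported in `(0,T)`,
`∫₀ᵀ∫ p div Φ = ∫₀ᵀ∫ p ⟪u ⋆ K, ∇ψ⟫ + ∫₀ᵀ∫ (p ⋆ K) ⟪u, ∇ψ⟫`, `Φ = ψ(u ⋆ K) + (ψu) ⋆ K`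
(`Torus.divergence_symmTestField` and the adjointness of `⋆ K` for even `K`). [cite: Novack2024, Sect. 2 Step 1 (last:one)] -/
theorem integral_pressure_divergence_symmTestField_eq
    (hum : AEStronglyMeasurable (uncurry u) ((volume.restrict (Ioo 0 T)).prod volume))
    (hu3 : ∫⁻ t in Ioo 0 T, ∫⁻ x, ‖u t x‖ₑ ^ 3 < ⊤)
    (hdiv : ∀ᵐ t ∂(volume.restrict (Ioo 0 T)), FunctionSpaces.Torus.IsWeaklyDivFree (u t))
    (hpm : AEStronglyMeasurable (uncurry p) ((volume.restrict (Ioo 0 T)).prod volume))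
    (hp : ∫⁻ t in Ioo 0 T, ∫⁻ x, ‖p t x‖ₑ ^ (3 / 2 : ℝ) < ⊤)
    (hK : FunctionSpaces.Torus.IsSmooth K) (hKev : ∀ z, K (-z) = K z)
    (hψ : FunctionSpaces.Torus.IsSpaceTimeTestIoo T ψ) :
    ∫ t in Ioo 0 T, ∫ x, p t x * FunctionSpaces.Torus.divergence (symmTestField K (ψ t) (u t)) x =
      (∫ t in Ioo 0 T, ∫ x, p t x * ⟪vecConv (u t) K x, FunctionSpaces.Torus.gradient (ψ t) x⟫) +
        ∫ t in Ioo 0 T, ∫ x, (p t ⋆ K) x * ⟪u t x, FunctionSpaces.Torus.gradient (ψ t) x⟫ := by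
  set μ : Measure ℝ := volume.restrict (Ioo 0 T) with hμ
  set μT := μ.prod (volume : Measure (UnitAddTorus d)) with hμT
  -- test-field and kernel data
  have hψs : ∀ t, FunctionSpaces.Torus.IsSmooth (ψ t) := fun t => hψ.isSpaceTimeTest.isSmooth_slice t
  obtain ⟨-, -, hgr, -⟩ := hψ.isSpaceTimeTest.isSmoothSpaceTimeOn_derived
  obtain ⟨⟨Cg, hCg0, hCg⟩, hgm⟩ := hgr.bound_and_measurable T
  obtain ⟨CK, hCK⟩ := FunctionSpaces.Torus.exists_forall_norm_le_of_continuous hK.continuous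
  have hCK0 : 0 ≤ CK := (norm_nonneg _).trans (hCK 0)
  have hIoo : ∀ᵐ z ∂μT, z.1 ∈ Ioo 0 T := by
    rw [hμT, hμ, ← volume_restrict_Ioo_prod_univ]
    filter_upwards [ae_restrict_mem (measurableSet_Ioo.prod MeasurableSet.univ)] with z hz
    exact hz.1
  -- a.e. slices: `u(t) ∈ L¹`, weakly divergence free, `p(t) ∈ L¹`
  have hU3 : ∫⁻ z, ‖u z.1 z.2‖ₑ ^ (3 : ℝ) ∂μT < ⊤ := by
    have e : ∫⁻ t in Ioo 0 T, ∫⁻ x, ‖u t x‖ₑ ^ (3 : ℝ) = ∫⁻ z, ‖u z.1 z.2‖ₑ ^ (3 : ℝ) ∂μT :=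
      lintegral_Ioo_lintegral_eq_lintegral_prod (hum.enorm.pow_const _)
    rw [← e]
    simpa only [ENNReal.rpow_ofNat] using hu3
  have hP32 : ∫⁻ z, ‖p z.1 z.2‖ₑ ^ (3 / 2 : ℝ) ∂μT < ⊤ := by
    have e : ∫⁻ t in Ioo 0 T, ∫⁻ x, ‖p t x‖ₑ ^ (3 / 2 : ℝ) = ∫⁻ z, ‖p z.1 z.2‖ₑ ^ (3 / 2 : ℝ) ∂μT :=
      lintegral_Ioo_lintegral_eq_lintegral_prod (hpm.enorm.pow_const _)
    rwa [← e]
  have hu1 : ∀ᵐ t ∂μ, Integrable (u t) volume := by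
    have h3 := FunctionSpaces.Torus.ae_memLp_of_lintegral_prod_rpow_lt_top hum (by norm_num : (0:ℝ) < 3) hU3
    filter_upwards [h3] with t ht
    exact ht.integrable (by rw [← ENNReal.ofReal_one]; exact ENNReal.ofReal_le_ofReal (by norm_num))
  have hp1 : ∀ᵐ t ∂μ, Integrable (p t) volume := by
    have h32 := FunctionSpaces.Torus.ae_memLp_of_lintegral_prod_rpow_lt_top hpm
      (by norm_num : (0:ℝ) < 3 / 2) hP32
    filter_upwards [h32] with t ht
    exact ht.integrable (by rw [← ENNReal.ofReal_one]; exact ENNReal.ofReal_le_ofReal (by norm_num))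
  -- the weight `g = ⟪u, ∇ψ⟫`
  set g : ℝ → UnitAddTorus d → ℝ := fun t x => ⟪u t x, FunctionSpaces.Torus.gradient (ψ t) x⟫ with hg
  have hgi : ∀ᵐ t ∂μ, Integrable (g t) volume := by
    filter_upwards [hu1] with t ht
    exact integrable_inner_continuous ht (hψs t).gradient.continuous
  -- the slice identity
  have hid : ∀ᵐ t ∂μ,
      (∫ x, p t x * FunctionSpaces.Torus.divergence (symmTestField K (ψ t) (u t)) x) =
        (∫ x, p t x * ⟪vecConv (u t) K x, FunctionSpaces.Torus.gradient (ψ t) x⟫) +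
          ∫ x, (p t ⋆ K) x * g t x := by
    filter_upwards [hu1, hdiv, hp1, hgi] with t hut hdt hpt hgt
    have h1 : Integrable (fun x => p t x * ⟪vecConv (u t) K x, FunctionSpaces.Torus.gradient (ψ t) x⟫)
        volume :=
      integrable_mul_continuous hpt
        ((isSmooth_vecConv hut hK).continuous.inner (hψs t).gradient.continuous)
    have h2 : Integrable (fun x => p t x * (g t ⋆ K) x) volume :=
      integrable_mul_continuous hpt (FunctionSpaces.Torus.continuous_convolution hgt hK.continuous)
    calc (∫ x, p t x * FunctionSpaces.Torus.divergence (symmTestField K (ψ t) (u t)) x)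
        = ∫ x, (p t x * ⟪vecConv (u t) K x, FunctionSpaces.Torus.gradient (ψ t) x⟫ +
            p t x * (g t ⋆ K) x) := by
          refine integral_congr_ae (ae_of_all _ fun x => ?_)
          dsimp only
          rw [divergence_symmTestField hK (hψs t) hut hdt x, mul_add]
      _ = (∫ x, p t x * ⟪vecConv (u t) K x, FunctionSpaces.Torus.gradient (ψ t) x⟫) +
            ∫ x, p t x * (g t ⋆ K) x := integral_add h1 h2
      _ = _ := by
          rw [FunctionSpaces.Torus.integral_mul_convolution_comm hpt hgt hK.continuous hKev]
  -- integrability of the two product integrands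
  have hgood : ∀ᵐ z ∂μT, Integrable (u z.1) volume ∧ Integrable (p z.1) volume :=
    ae_prod_of_ae_left ((hu1.and hp1).mono fun t ht => fun _ => ht)
  have iP1 : Integrable (fun z : ℝ × UnitAddTorus d =>
      p z.1 z.2 * ⟪vecConv (u z.1) K z.2, FunctionSpaces.Torus.gradient (ψ z.1) z.2⟫) μT := by
    refine ((integrable_pressure_mul_sliceNorm hum hu3 hpm hp).const_mul
      (Fintype.card d * CK * Cg)).mono'
      (hpm.mul ((aestronglyMeasurable_uncurry_vecConv hum hK.continuous).inner hgm)) ?_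
    filter_upwards [hIoo, hgood] with z hz hz1
    have hv := norm_vecConv_le hz1.1 hCK z.2
    have hN0 : 0 ≤ ∫ y, ‖u z.1 y‖ := integral_nonneg fun y => norm_nonneg _
    rw [norm_mul]
    calc ‖p z.1 z.2‖ * ‖⟪vecConv (u z.1) K z.2, FunctionSpaces.Torus.gradient (ψ z.1) z.2⟫‖
        ≤ ‖p z.1 z.2‖ * ((Fintype.card d * (CK * ∫ y, ‖u z.1 y‖)) * Cg) := by
          refine mul_le_mul_of_nonneg_left ?_ (norm_nonneg _)
          exact (norm_inner_le_norm _ _).trans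
            (mul_le_mul hv (hCg z.1 (Ioo_subset_Icc_self hz) z.2) (norm_nonneg _) (by positivity))
      _ = Fintype.card d * CK * Cg * (‖p z.1 z.2‖ * ∫ y, ‖u z.1 y‖) := by ring
  have iP2 : Integrable (fun z : ℝ × UnitAddTorus d => (p z.1 ⋆ K) z.2 * g z.1 z.2) μT := by
    refine ((integrable_sliceNorm_pressure_mul hum hu3 hpm hp).const_mul (CK * Cg)).mono'
      ((FunctionSpaces.Torus.aestronglyMeasurable_uncurry_convolution (ContinuousLinearMap.lsmul ℝ ℝ)
        hpm hK.continuous).mul (hum.inner hgm)) ?_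
    filter_upwards [hIoo, hgood] with z hz hz1
    have hconv : ‖(p z.1 ⋆ K) z.2‖ ≤ CK * ∫ y, ‖p z.1 y‖ :=
      FunctionSpaces.Torus.norm_convolution_le hz1.2 hCK z.2
    have hi : ‖g z.1 z.2‖ ≤ ‖u z.1 z.2‖ * Cg :=
      (norm_inner_le_norm _ _).trans
        (mul_le_mul_of_nonneg_left (hCg z.1 (Ioo_subset_Icc_self hz) z.2) (norm_nonneg _))
    have hN0 : 0 ≤ ∫ y, ‖p z.1 y‖ := integral_nonneg fun y => norm_nonneg _
    rw [norm_mul]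
    calc ‖(p z.1 ⋆ K) z.2‖ * ‖g z.1 z.2‖ ≤ (CK * ∫ y, ‖p z.1 y‖) * (‖u z.1 z.2‖ * Cg) :=
          mul_le_mul hconv hi (norm_nonneg _) (by positivity)
      _ = CK * Cg * ((∫ y, ‖p z.1 y‖) * ‖u z.1 z.2‖) := by ring
  rw [integral_congr_ae hid, integral_add iP1.integral_prod_left iP2.integral_prod_left]

/-- **Novack's scale balance for a smooth radial kernel, `γ > 0`** (Novack 2024, §2 Step 1,
(eq:main:balance) with `γ > 0`, `ν = 0`, `f = 0`, tested against `ψ` supported in `(0,T)` and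
multiplied by `2`): granted the tested momentum equation
`IsDistributionalNSSolutionOn.symmTestField_identity` (Duchon–Robert's "(NS)·u^ε + (NS^ε)·u",
Novack's (eq:1) + (eq:2)), for a distributional Euler solution `(u, p)` on `(0,T) × T^d` with
`u ∈ L³_{t,x}`, `p ∈ L^{3/2}_{t,x}` and every smooth even kernel `K`,
`𝒩[K](ψ) = ∫₀ᵀ∫ 𝒟_K(u) ψ`, where `𝒟_K(u)(x) = ∫ ⟪∇K(z), δu(x;z)⟫|δu(x;z)|² dz`
(`Torus.kernelFlux`) is `−2 · (−2 D_{I,ℓ,γ})` read through `K`: the cubic identity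
(`Torus.integral_kernelFlux_mul_eq_holds`, Novack's (eq:adding)–(DR)), the tested equation, and
the split pressure pairing (`integral_pressure_divergence_symmTestField_eq`). [cite: Novack2024, Sect. 2 Step 1 (eq:main:balance) with γ > 0] -/
theorem novackKernelPairing_eq_integral_kernelFlux
    (hEq : IsDistributionalNSSolutionOn.symmTestField_identity (d := d))
    (hsol : IsDistributionalNSSolutionOn T 0 0 u p)
    (hu3 : ∫⁻ t in Ioo 0 T, ∫⁻ x, ‖u t x‖ₑ ^ 3 < ⊤)
    (hp : ∫⁻ t in Ioo 0 T, ∫⁻ x, ‖p t x‖ₑ ^ (3 / 2 : ℝ) < ⊤)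
    (hK : FunctionSpaces.Torus.IsSmooth K) (hKev : ∀ z, K (-z) = K z)
    (hψ : FunctionSpaces.Torus.IsSpaceTimeTestIoo T ψ) :
    novackKernelPairing T u p ψ K = ∫ t in Ioo 0 T, ∫ x, kernelFlux K (u t) x * ψ t x := by
  have h2 := integral_kernelFlux_mul_eq_holds hsol.1 hu3 hsol.2.2.2.2.1 hK hKev hψ
  have h3 := hEq hsol hu3 hp hK hKev hψ
  have h4 := integral_pressure_divergence_symmTestField_eq (aestronglyMeasurable_uncurry_prod hsol.1)
    hu3 hsol.2.2.2.2.1 (aestronglyMeasurable_uncurry_prod hsol.2.2.1) hp hK hKev hψ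
  rw [zero_mul, add_zero, h4] at h3
  rw [novackKernelPairing, h2]
  linear_combination (2 : ℝ) * h3

end KernelBalance


end PartA

/-! ## The ball kernel, read on the torus, and the ball average as a torus integral -/

section TorusKernels

variable {d : Type*} [Fintype d] [DecidableEq d]

/-- **Novack's ball kernel** `η_{ℓ,0} = |B_ℓ|⁻¹ 1_{B_ℓ}` on `ℝ^d` (Novack 2024, §2: "when
`γ = 0` … convolution with `η_{ℓ,γ}` induces a weighted integral over the ball of radius `ℓ`";
normalised so that `f ⋆ η_{ℓ,0} = ⨍_{B_ℓ} f`, `Torus.ballAvg`). [cite: Novack2024, Sect. 2 (increments) with γ = 0] -/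
def ballIndicatorKernel (ℓ : ℝ) (ξ : EuclideanSpace ℝ d) : ℝ :=
  ((volume : Measure (EuclideanSpace ℝ d)).real (ball 0 ℓ))⁻¹ * (ball (0 : EuclideanSpace ℝ d) ℓ).indicator 1 ξ

/-- The ball kernel read on the torus: the periodisation `∑ₖ η_{ℓ,0}(· + k)` (`Torus.periodize`). [cite: Novack2024, Sect. 2 (increments) with γ = 0] -/
def ballTorusKernel (ℓ : ℝ) : UnitAddTorus d → ℝ :=
  FunctionSpaces.Torus.periodize (ballIndicatorKernel ℓ)

variable {ℓ : ℝ}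

omit [DecidableEq d] in
/-- Unfolding `ballIndicatorKernel`. [folklore] -/
theorem ballIndicatorKernel_apply (ℓ : ℝ) (ξ : EuclideanSpace ℝ d) :
    ballIndicatorKernel ℓ ξ =
      ((volume : Measure (EuclideanSpace ℝ d)).real (ball 0 ℓ))⁻¹ * (ball (0 : EuclideanSpace ℝ d) ℓ).indicator 1 ξ :=
  rfl

omit [DecidableEq d] in
/-- The support of the ball kernel lies in the closed ball of radius `ℓ`. [folklore] -/
theorem support_ballIndicatorKernel_subset (ℓ : ℝ) :
    support (ballIndicatorKernel (d := d) ℓ) ⊆ closedBall 0 ℓ := by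
  intro ξ hξ
  by_contra h
  refine hξ ?_
  rw [ballIndicatorKernel_apply, indicator_of_notMem (fun hb => h (ball_subset_closedBall hb)), mul_zero]

omit [DecidableEq d] in
/-- The ball kernel is even. [folklore] -/
theorem ballIndicatorKernel_neg (ℓ : ℝ) (ξ : EuclideanSpace ℝ d) :
    ballIndicatorKernel ℓ (-ξ) = ballIndicatorKernel ℓ ξ := by
  rw [ballIndicatorKernel_apply, ballIndicatorKernel_apply]
  congr 1
  by_cases h : ξ ∈ ball (0 : EuclideanSpace ℝ d) ℓ
  · rw [indicator_of_mem h, indicator_of_mem (by simpa using h), Pi.one_apply, Pi.one_apply]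
  · rw [indicator_of_notMem h, indicator_of_notMem (by simpa using h)]

omit [DecidableEq d] in
/-- `|ballIndicatorKernel| ≤ |B_ℓ|⁻¹`. [folklore] -/
theorem abs_ballIndicatorKernel_le (ℓ : ℝ) (ξ : EuclideanSpace ℝ d) :
    |ballIndicatorKernel ℓ ξ| ≤ ((volume : Measure (EuclideanSpace ℝ d)).real (ball 0 ℓ))⁻¹ := by
  have hc : 0 ≤ ((volume : Measure (EuclideanSpace ℝ d)).real (ball 0 ℓ))⁻¹ := inv_nonneg.2 measureReal_nonneg
  have hi : (ball (0 : EuclideanSpace ℝ d) ℓ).indicator (1 : EuclideanSpace ℝ d → ℝ) ξ ∈ Icc (0 : ℝ) 1 := by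
    by_cases h : ξ ∈ ball (0 : EuclideanSpace ℝ d) ℓ
    · rw [indicator_of_mem h]; simp
    · rw [indicator_of_notMem h]; simp
  rw [ballIndicatorKernel_apply, abs_mul, abs_of_nonneg hc, abs_of_nonneg hi.1]
  exact mul_le_of_le_one_right hc hi.2

omit [DecidableEq d] in
/-- The ball kernel is measurable. [folklore] -/
theorem measurable_ballIndicatorKernel (ℓ : ℝ) : Measurable (ballIndicatorKernel (d := d) ℓ) :=
  measurable_const.mul (measurable_const.indicator measurableSet_ball)

/-- The ball torus kernel is even (`Torus.periodize_neg_of_even`, `NovackKernelFamily`). [folklore] -/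
theorem ballTorusKernel_neg (ℓ : ℝ) (z : UnitAddTorus d) :
    ballTorusKernel ℓ (-z) = ballTorusKernel ℓ z :=
  periodize_neg_of_even (ballIndicatorKernel_neg ℓ) z

/-- **Finite-sum form of a periodisation** of a function supported in `B̄(0, ℓ)`:
`z ↦ ∑_{k ∈ W} g(repr z + k)` with the window `W = latticeWindow d n`, `n ≥ ℓ + card d`. [folklore] -/
theorem periodize_eq_sum_of_support {g : EuclideanSpace ℝ d → ℝ} (hg : support g ⊆ closedBall 0 ℓ)
    {n : ℕ} (hn : ℓ + Fintype.card d ≤ n) (z : UnitAddTorus d) :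
    FunctionSpaces.Torus.periodize g z =
      ∑ k ∈ FunctionSpaces.Torus.latticeWindow d n, g (FunctionSpaces.Torus.repr z + FunctionSpaces.Torus.latticeVec k) :=
  FunctionSpaces.Torus.perSum_eq_sum_of_mem_unitCube hg (FunctionSpaces.Torus.repr_mem_unitCube z) hn

/-- **Uniform bound for a periodisation**: `|∑ₖ g(repr z + k)| ≤ #W · C` if `|g| ≤ C` is supported
in `B̄(0, ℓ)`. [folklore] -/
theorem abs_periodize_le_of_support {g : EuclideanSpace ℝ d → ℝ} (hg : support g ⊆ closedBall 0 ℓ)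
    {C : ℝ} (hC : ∀ ξ, |g ξ| ≤ C) {n : ℕ} (hn : ℓ + Fintype.card d ≤ n) (z : UnitAddTorus d) :
    |FunctionSpaces.Torus.periodize g z| ≤ (FunctionSpaces.Torus.latticeWindow d n).card * C := by
  rw [periodize_eq_sum_of_support hg hn z]
  refine (Finset.abs_sum_le_sum_abs _ _).trans ?_
  calc ∑ k ∈ FunctionSpaces.Torus.latticeWindow d n, |g (FunctionSpaces.Torus.repr z + FunctionSpaces.Torus.latticeVec k)|
      ≤ ∑ _k ∈ FunctionSpaces.Torus.latticeWindow d n, C := Finset.sum_le_sum fun k _ => hC _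
    _ = (FunctionSpaces.Torus.latticeWindow d n).card * C := by rw [Finset.sum_const, nsmul_eq_mul]

/-- The ball torus kernel is measurable. [folklore] -/
theorem measurable_ballTorusKernel (ℓ : ℝ) : Measurable (ballTorusKernel (d := d) ℓ) := by
  obtain ⟨n, hn⟩ := exists_nat_ge (ℓ + Fintype.card d)
  have h : ballTorusKernel (d := d) ℓ = fun z => ∑ k ∈ FunctionSpaces.Torus.latticeWindow d n,
      ballIndicatorKernel ℓ (FunctionSpaces.Torus.repr z + FunctionSpaces.Torus.latticeVec k) :=
    funext fun z => periodize_eq_sum_of_support (support_ballIndicatorKernel_subset ℓ) hn z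
  rw [h]
  refine Finset.measurable_sum _ fun k _ => ?_
  exact (measurable_ballIndicatorKernel ℓ).comp (FunctionSpaces.Torus.measurable_repr.add_const _)

/-- Uniform bound for the ball torus kernel. [folklore] -/
theorem abs_ballTorusKernel_le {n : ℕ} (hn : ℓ + Fintype.card d ≤ n) (z : UnitAddTorus d) :
    |ballTorusKernel ℓ z| ≤
      (FunctionSpaces.Torus.latticeWindow d n).card * ((volume : Measure (EuclideanSpace ℝ d)).real (ball 0 ℓ))⁻¹ :=
  abs_periodize_le_of_support (support_ballIndicatorKernel_subset ℓ) (abs_ballIndicatorKernel_le ℓ) hn z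

/-! ### Mollification by an even kernel as a weighted translate integral; the ball average -/

omit [DecidableEq d] in
/-- Mollification by an **even** kernel is a weighted integral of translates:
`(θ ⋆ K)(x) = ∫ K(z) θ(x + z) dz` (translation invariance of Haar measure on `T^d`; first step of
`Torus.convolution_periodize_apply`, `NovackKernelAverages`, here for a possibly discontinuous
`K`). [folklore] -/
theorem convolution_eq_integral_mul_translate (θ K : UnitAddTorus d → ℝ) (hKe : ∀ z, K (-z) = K z)
    (x : UnitAddTorus d) : (θ ⋆ K) x = ∫ z, K z * θ (x + z) := by
  rw [convolution_lsmul, ← integral_add_left_eq_self _ x]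
  refine integral_congr_ae (ae_of_all _ fun z => ?_)
  dsimp only
  rw [smul_eq_mul, show x - (x + z) = -z by abel, hKe, mul_comm]

omit [DecidableEq d] in
/-- Componentwise mollification by a bounded measurable **even** kernel as a vector-valued weighted
integral of translates: `(v ⋆ K)(x) = ∫ K(z) v(x + z) dz` for `v ∈ L¹`. [folklore] -/
theorem vecConv_eq_integral_smul_translate {v : UnitAddTorus d → EuclideanSpace ℝ d}
    (hv : Integrable v volume) {K : UnitAddTorus d → ℝ} (hKm : AEStronglyMeasurable K volume)
    {C : ℝ} (hKb : ∀ z, |K z| ≤ C) (hKe : ∀ z, K (-z) = K z) (x : UnitAddTorus d) :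
    vecConv v K x = ∫ z, K z • v (x + z) := by
  have hint : Integrable (fun z => K z • v (x + z)) volume := by
    have h := Integrable.bdd_smul (hv.comp_add_left x) C hKm (ae_of_all _ fun z => by
      rw [Real.norm_eq_abs]; exact hKb z)
    exact h
  ext i
  rw [vecConv_apply, convolution_eq_integral_mul_translate _ _ hKe]
  have h := (EuclideanSpace.proj i : EuclideanSpace ℝ d →L[ℝ] ℝ).integral_comp_comm hint
  have h' : (fun z => (EuclideanSpace.proj i : EuclideanSpace ℝ d →L[ℝ] ℝ) (K z • v (x + z))) =
      fun z => K z * v (x + z) i := by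
    funext z
    rfl
  rw [h'] at h
  exact h

/-- **The ball average as a torus integral against the periodised ball kernel**: for
`f ∈ L¹(T^d)`, `∫_{T^d} K_{B_ℓ}(z) f(x + z) dz = ⨍_{B_ℓ} f(x + y) dy` (`Torus.ballAvg`; unfolding
`Torus.integral_eq_integral_perSum_repr` of `y ↦ |B_ℓ|⁻¹ 1_{B_ℓ}(y) f(x + proj y)`; the
vector-valued, indicator-kernel companion of `Torus.convolution_periodize_apply`). [folklore] -/
theorem integral_ballTorusKernel_smul_translate {F : Type*} [NormedAddCommGroup F]
    [NormedSpace ℝ F] [CompleteSpace F] {f : UnitAddTorus d → F} (hf : Integrable f volume) (ℓ : ℝ)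
    (x : UnitAddTorus d) : ∫ z, ballTorusKernel ℓ z • f (x + z) = ballAvg f ℓ x := by
  set c : ℝ := ((volume : Measure (EuclideanSpace ℝ d)).real (ball 0 ℓ))⁻¹ with hc
  set Φ : EuclideanSpace ℝ d → F := fun y => ballIndicatorKernel ℓ y • f (x + FunctionSpaces.Torus.proj y)
    with hΦ
  have hΦ_eq : Φ = (ball (0 : EuclideanSpace ℝ d) ℓ).indicator
      fun y => c • f (x + FunctionSpaces.Torus.proj y) := by
    funext y
    by_cases hy : y ∈ ball (0 : EuclideanSpace ℝ d) ℓ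
    · rw [hΦ, indicator_of_mem hy]
      dsimp only
      rw [ballIndicatorKernel_apply, indicator_of_mem hy, Pi.one_apply, mul_one]
    · rw [hΦ, indicator_of_notMem hy]
      dsimp only
      rw [ballIndicatorKernel_apply, indicator_of_notMem hy, mul_zero, zero_smul]
  have hsupp : support Φ ⊆ closedBall 0 ℓ := by
    rw [hΦ_eq]
    exact (support_indicator_subset).trans ball_subset_closedBall
  have hlift : IntegrableOn (fun y : EuclideanSpace ℝ d => f (x + FunctionSpaces.Torus.proj y))
      (ball 0 ℓ) volume :=
    FunctionSpaces.Torus.integrableOn_lift_of_subset_closedBall (H := fun w => f (x + w))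
      (hf.comp_add_left x) ball_subset_closedBall
  have hΦi : Integrable Φ volume := by
    rw [hΦ_eq]
    exact IntegrableOn.integrable_indicator (hlift.smul c) measurableSet_ball
  have h1 : ∫ y, Φ y = ∫ z : UnitAddTorus d, FunctionSpaces.Torus.perSum Φ (FunctionSpaces.Torus.repr z) :=
    FunctionSpaces.Torus.integral_eq_integral_perSum_repr hΦi hsupp
  have h2 : ∀ z : UnitAddTorus d, FunctionSpaces.Torus.perSum Φ (FunctionSpaces.Torus.repr z) =
      ballTorusKernel ℓ z • f (x + z) := by
    intro z
    have hz : ‖FunctionSpaces.Torus.repr z‖ ≤ Fintype.card d :=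
      FunctionSpaces.Torus.norm_le_card_of_mem_unitCube (FunctionSpaces.Torus.repr_mem_unitCube z)
    obtain ⟨n, hn⟩ := exists_nat_ge (ℓ + Fintype.card d)
    rw [FunctionSpaces.Torus.perSum_eq_sum hsupp hz hn, ballTorusKernel, FunctionSpaces.Torus.periodize_apply,
      FunctionSpaces.Torus.perSum_eq_sum (support_ballIndicatorKernel_subset ℓ) hz hn, Finset.sum_smul]
    refine Finset.sum_congr rfl fun k _ => ?_
    simp only [hΦ, FunctionSpaces.Torus.proj_add_latticeVec, FunctionSpaces.Torus.proj_repr]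
  simp_rw [← h2]
  rw [← h1, hΦ_eq, integral_indicator measurableSet_ball, ballAvg, setAverage_eq, integral_smul]

end TorusKernels

/-! ## Novack's kernels at fixed scale `ℓ`: the tree's plateau mollifiers, rescaled -/

section PlateauKernels

variable {d : Type*} [Fintype d] [DecidableEq d]
variable {ℓ : ℝ}

omit [DecidableEq d] in
/-- The plateau bumps increase with the plateau parameter: `ρ_m ≤ ρ_{m'}` for `0 ≤ m ≤ m'`. [folklore] -/
theorem plateauBump_mono {m m' : ℝ} (hm : 0 ≤ m) (hmm' : m ≤ m') (ξ : EuclideanSpace ℝ d) :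
    plateauBump m ξ ≤ plateauBump m' ξ := by
  by_cases h : ‖ξ‖ ≤ 1
  · exact Real.smoothTransition.monotone (mul_le_mul_of_nonneg_right hmm' (by linarith))
  · rw [plateauBump_eq_zero hm (le_of_lt (not_le.1 h)), plateauBump_eq_zero (hm.trans hmm') (le_of_lt (not_le.1 h))]

omit [DecidableEq d] in
/-- The masses of the plateau bumps are bounded below by the mass at `m = 2`, for `m ≥ 2`. [folklore] -/
theorem integral_plateauBump_two_le {m : ℝ} (hm : 2 ≤ m) :
    ∫ η : EuclideanSpace ℝ d, plateauBump 2 η ≤ ∫ η : EuclideanSpace ℝ d, plateauBump m η :=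
  integral_mono (integrable_plateauBump _ one_lt_two) (integrable_plateauBump _ (by linarith))
    fun η => plateauBump_mono zero_le_two hm η

omit [DecidableEq d] in
/-- **Uniform bound for the rescaled plateau mollifiers** at scale `ℓ > 0`, `m ≥ 2`:
`|φ_m^ℓ| ≤ ℓ^{-d} (∫ρ₂)⁻¹`. [folklore] -/
theorem abs_mollifierScale_plateauMollifier_le [Nonempty d] (hℓ : 0 < ℓ) {m : ℝ} (hm : 2 ≤ m) (ξ : EuclideanSpace ℝ d) :
    |FluidPDE.mollifierScale ℓ (plateauMollifier d m) ξ| ≤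
      (ℓ ^ Fintype.card d)⁻¹ * (∫ η : EuclideanSpace ℝ d, plateauBump 2 η)⁻¹ := by
  have h2 : 0 < ∫ η : EuclideanSpace ℝ d, plateauBump 2 η := integral_plateauBump_pos volume one_lt_two
  have hm' : 0 < ∫ η : EuclideanSpace ℝ d, plateauBump m η := integral_plateauBump_pos volume (by linarith)
  rw [FluidPDE.mollifierScale_apply, plateauMollifier_apply, abs_mul, abs_mul,
    abs_of_nonneg (inv_nonneg.2 (pow_nonneg hℓ.le _)), abs_of_nonneg (inv_nonneg.2 hm'.le),
    abs_of_nonneg (plateauBump_nonneg _ _)]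
  refine mul_le_mul_of_nonneg_left ?_ (inv_nonneg.2 (pow_nonneg hℓ.le _))
  calc (∫ η : EuclideanSpace ℝ d, plateauBump m η)⁻¹ * plateauBump m (ℓ⁻¹ • ξ)
      ≤ (∫ η : EuclideanSpace ℝ d, plateauBump m η)⁻¹ * 1 :=
        mul_le_mul_of_nonneg_left (plateauBump_le_one _ _) (inv_nonneg.2 hm'.le)
    _ ≤ (∫ η : EuclideanSpace ℝ d, plateauBump 2 η)⁻¹ := by
        rw [mul_one]; exact inv_anti₀ h2 (integral_plateauBump_two_le hm)

omit [DecidableEq d] in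
/-- The rescaled plateau mollifiers at scale `ℓ > 0` are supported in the closed ball of radius
`ℓ` (`m ≥ 0`). [folklore] -/
theorem support_mollifierScale_plateauMollifier_subset (hℓ : 0 < ℓ) {m : ℝ} (hm : 0 ≤ m) :
    support (FluidPDE.mollifierScale ℓ (plateauMollifier d m)) ⊆ closedBall 0 ℓ := by
  intro ξ hξ
  rw [mem_closedBall, dist_zero_right]
  by_contra h
  refine hξ ?_
  rw [FluidPDE.mollifierScale_apply, plateauMollifier_eq_zero hm, mul_zero]
  rw [norm_smul, norm_inv, Real.norm_eq_abs, abs_of_pos hℓ]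
  exact (one_le_inv_mul₀ hℓ).2 (le_of_lt (not_le.1 h))

omit [DecidableEq d] in
/-- Eventually (in the plateau parameter `m = k + 2`) the plateau bump is `1` at a point of the
open unit ball. [folklore] -/
theorem eventually_plateauBump_eq_one {η : EuclideanSpace ℝ d} (hη : ‖η‖ < 1) :
    ∀ᶠ k : ℕ in atTop, plateauBump ((k : ℝ) + 2) η = 1 := by
  have hpos : 0 < 1 - ‖η‖ := by linarith
  obtain ⟨N, hN⟩ := exists_nat_gt (1 - ‖η‖)⁻¹
  filter_upwards [eventually_ge_atTop N] with k hk
  have hk0 : (0 : ℝ) < (k : ℝ) + 2 := by positivity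
  refine plateauBump_eq_one hk0 ?_
  have hk' : (1 - ‖η‖)⁻¹ ≤ (k : ℝ) + 2 := by
    have : (N : ℝ) ≤ k := by exact_mod_cast hk
    linarith
  have := inv_le_of_inv_le₀ hpos hk'
  linarith

omit [DecidableEq d] in
/-- **The rescaled plateau mollifiers converge to the ball kernel at every point** as the plateau
parameter `m = k + 2 → ∞` (on and outside the sphere `|ξ| = ℓ` both vanish; inside, the plateau
value `ℓ^{-d}(∫ρ_m)⁻¹ → |B_ℓ|⁻¹`). [folklore] -/
theorem tendsto_mollifierScale_plateauMollifier [Nonempty d] (hℓ : 0 < ℓ) (ξ : EuclideanSpace ℝ d) :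
    Tendsto (fun k : ℕ => FluidPDE.mollifierScale ℓ (plateauMollifier d ((k : ℝ) + 2)) ξ) atTop
      (𝓝 (ballIndicatorKernel ℓ ξ)) := by
  simp only [FluidPDE.mollifierScale_apply, plateauMollifier_apply, ballIndicatorKernel_apply]
  by_cases hξ : ‖ξ‖ < ℓ
  · have hmem : ξ ∈ ball (0 : EuclideanSpace ℝ d) ℓ := by rwa [mem_ball, dist_zero_right]
    rw [indicator_of_mem hmem, Pi.one_apply, mul_one]
    have hsc : ‖ℓ⁻¹ • ξ‖ < 1 := by
      rw [norm_smul, norm_inv, Real.norm_eq_abs, abs_of_pos hℓ]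
      exact (inv_mul_lt_one₀ hℓ).2 hξ
    have hvol : (volume : Measure (EuclideanSpace ℝ d)).real (ball 0 ℓ) =
        ℓ ^ Fintype.card d * (volume : Measure (EuclideanSpace ℝ d)).real (ball 0 1) := by
      rw [measureReal_def, Measure.addHaar_ball _ _ hℓ.le, ENNReal.toReal_mul,
        ENNReal.toReal_ofReal (pow_nonneg hℓ.le _), finrank_euclideanSpace, measureReal_def]
    have hV1 : (volume : Measure (EuclideanSpace ℝ d)).real (ball 0 1) ≠ 0 :=
      (ENNReal.toReal_pos (measure_ball_pos volume _ one_pos).ne' measure_ball_lt_top.ne).ne'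
    rw [hvol, mul_inv]
    have e : (fun k : ℕ => (ℓ ^ Fintype.card d)⁻¹ *
        ((∫ η : EuclideanSpace ℝ d, plateauBump ((k : ℝ) + 2) η)⁻¹ * plateauBump ((k : ℝ) + 2) (ℓ⁻¹ • ξ))) =ᶠ[atTop]
        fun k => (ℓ ^ Fintype.card d)⁻¹ * (∫ η : EuclideanSpace ℝ d, plateauBump ((k : ℝ) + 2) η)⁻¹ :=
      (eventually_plateauBump_eq_one hsc).mono fun k hk => by simp only [hk, mul_one]
    exact (((tendsto_integral_plateauBump (d := d)).inv₀ hV1).const_mul _).congr' e.symm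
  · have hnot : ξ ∉ ball (0 : EuclideanSpace ℝ d) ℓ := by rwa [mem_ball, dist_zero_right]
    rw [indicator_of_notMem hnot, mul_zero]
    have hzero : ∀ k : ℕ, plateauBump ((k : ℝ) + 2) (ℓ⁻¹ • ξ) = 0 := fun k => by
      refine plateauBump_eq_zero (by positivity) ?_
      rw [norm_smul, norm_inv, Real.norm_eq_abs, abs_of_pos hℓ]
      exact (one_le_inv_mul₀ hℓ).2 (not_lt.1 hξ)
    simp only [hzero, mul_zero]
    exact tendsto_const_nhds

/-- **Novack's torus kernels at scale `ℓ`**: the torus kernels `mollifierKernel (plateauMollifier d m) ℓ`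
of the plateau mollifiers are uniformly bounded for `m ≥ 2`. [folklore] -/
theorem abs_mollifierKernel_plateauMollifier_le [Nonempty d] (hℓ : 0 < ℓ) {m : ℝ} (hm : 2 ≤ m) {n : ℕ}
    (hn : ℓ + Fintype.card d ≤ n) (z : UnitAddTorus d) :
    |mollifierKernel (plateauMollifier d m) ℓ z| ≤ (FunctionSpaces.Torus.latticeWindow d n).card *
      ((ℓ ^ Fintype.card d)⁻¹ * (∫ η : EuclideanSpace ℝ d, plateauBump 2 η)⁻¹) :=
  abs_periodize_le_of_support (support_mollifierScale_plateauMollifier_subset hℓ (by linarith))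
    (abs_mollifierScale_plateauMollifier_le hℓ hm) hn z

/-- The torus kernels of the plateau mollifiers converge at every point to the ball torus kernel. [folklore] -/
theorem tendsto_mollifierKernel_plateauMollifier [Nonempty d] (hℓ : 0 < ℓ) (z : UnitAddTorus d) :
    Tendsto (fun k : ℕ => mollifierKernel (plateauMollifier d ((k : ℝ) + 2)) ℓ z) atTop
      (𝓝 (ballTorusKernel ℓ z)) := by
  obtain ⟨n, hn⟩ := exists_nat_ge (ℓ + Fintype.card d)
  have hev : ∀ k : ℕ, mollifierKernel (plateauMollifier d ((k : ℝ) + 2)) ℓ z =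
      ∑ i ∈ FunctionSpaces.Torus.latticeWindow d n, FluidPDE.mollifierScale ℓ (plateauMollifier d ((k : ℝ) + 2))
        (FunctionSpaces.Torus.repr z + FunctionSpaces.Torus.latticeVec i) := fun k =>
    periodize_eq_sum_of_support (support_mollifierScale_plateauMollifier_subset hℓ (by positivity)) hn z
  simp only [hev]
  rw [ballTorusKernel, periodize_eq_sum_of_support (support_ballIndicatorKernel_subset ℓ) hn z]
  exact tendsto_finsetSum _ fun i _ => tendsto_mollifierScale_plateauMollifier hℓ _

/-- **Mollifications by Novack's kernels converge to the ball average** (vector-valued weighted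
form): for `f ∈ L¹(T^d)`, `ℓ > 0` and every `x`,
`∫ K_m(z) f(x + z) dz → ∫ K_{B_ℓ}(z) f(x + z) dz` (dominated convergence on `T^d`). [folklore] -/
theorem tendsto_integral_mollifierKernel_smul [Nonempty d] {F : Type*} [NormedAddCommGroup F]
    [NormedSpace ℝ F] {f : UnitAddTorus d → F} (hf : Integrable f volume) (hℓ : 0 < ℓ) (x : UnitAddTorus d) :
    Tendsto (fun k : ℕ => ∫ z, mollifierKernel (plateauMollifier d ((k : ℝ) + 2)) ℓ z • f (x + z)) atTop
      (𝓝 (∫ z, ballTorusKernel ℓ z • f (x + z))) := by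
  obtain ⟨n, hn⟩ := exists_nat_ge (ℓ + Fintype.card d)
  set C : ℝ := (FunctionSpaces.Torus.latticeWindow d n).card *
    ((ℓ ^ Fintype.card d)⁻¹ * (∫ η : EuclideanSpace ℝ d, plateauBump 2 η)⁻¹) with hC
  have hm : ∀ k : ℕ, (1 : ℝ) < (k : ℝ) + 2 := fun k => by
    have : (0 : ℝ) ≤ k := Nat.cast_nonneg k
    linarith
  refine tendsto_integral_of_dominated_convergence (fun z => C * ‖f (x + z)‖) ?_
    ((hf.comp_add_left x).norm.const_mul C) ?_ (ae_of_all _ fun z =>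
      (tendsto_mollifierKernel_plateauMollifier hℓ z).smul_const _)
  · exact fun k => (isSmooth_mollifierKernel (isUnitBallMollifier_plateauMollifier (hm k)).isMollifier
      hℓ).continuous.aestronglyMeasurable.smul (hf.comp_add_left x).aestronglyMeasurable
  · intro k
    refine ae_of_all _ fun z => ?_
    rw [norm_smul, Real.norm_eq_abs]
    exact mul_le_mul_of_nonneg_right (abs_mollifierKernel_plateauMollifier_le hℓ (by
      have : (0 : ℝ) ≤ k := Nat.cast_nonneg k; linarith) hn z) (norm_nonneg _)

/-- **Componentwise mollifications by Novack's kernels converge to the ball average**: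
`(v ⋆ K_m)(x) → v^ℓ(x)` for `v ∈ L¹(T^d; ℝ^d)`, `ℓ > 0` and every `x`. [folklore] -/
theorem tendsto_vecConv_mollifierKernel [Nonempty d] {v : UnitAddTorus d → EuclideanSpace ℝ d}
    (hv : Integrable v volume) (hℓ : 0 < ℓ) (x : UnitAddTorus d) :
    Tendsto (fun k : ℕ => vecConv v (mollifierKernel (plateauMollifier d ((k : ℝ) + 2)) ℓ) x) atTop
      (𝓝 (ballAvg v ℓ x)) := by
  obtain ⟨n, hn⟩ := exists_nat_ge (ℓ + Fintype.card d)
  have hm : ∀ k : ℕ, (1 : ℝ) < (k : ℝ) + 2 := fun k => by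
    have : (0 : ℝ) ≤ k := Nat.cast_nonneg k
    linarith
  have hev : ∀ k : ℕ, vecConv v (mollifierKernel (plateauMollifier d ((k : ℝ) + 2)) ℓ) x =
      ∫ z, mollifierKernel (plateauMollifier d ((k : ℝ) + 2)) ℓ z • v (x + z) := fun k =>
    vecConv_eq_integral_smul_translate hv
      (isSmooth_mollifierKernel (isUnitBallMollifier_plateauMollifier (hm k)).isMollifier hℓ).continuous.aestronglyMeasurable
      (abs_mollifierKernel_plateauMollifier_le hℓ (by have : (0 : ℝ) ≤ k := Nat.cast_nonneg k; linarith) hn)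
      (mollifierKernel_neg (isUnitBallMollifier_plateauMollifier (hm k)).isMollifier ℓ) x
  simp only [hev]
  rw [← integral_ballTorusKernel_smul_translate hv ℓ x]
  exact tendsto_integral_mollifierKernel_smul hv hℓ x

/-- **Scalar mollifications by Novack's kernels converge to the ball average**:
`(θ ⋆ K_m)(x) → θ^ℓ(x)` for `θ ∈ L¹(T^d)`, `ℓ > 0` and every `x`. [folklore] -/
theorem tendsto_convolution_mollifierKernel [Nonempty d] {θ : UnitAddTorus d → ℝ}
    (hθ : Integrable θ volume) (hℓ : 0 < ℓ) (x : UnitAddTorus d) :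
    Tendsto (fun k : ℕ => (θ ⋆ mollifierKernel (plateauMollifier d ((k : ℝ) + 2)) ℓ) x) atTop (𝓝 (ballAvg θ ℓ x)) := by
  have hm : ∀ k : ℕ, (1 : ℝ) < (k : ℝ) + 2 := fun k => by
    have : (0 : ℝ) ≤ k := Nat.cast_nonneg k
    linarith
  have hev : (fun k : ℕ => (θ ⋆ mollifierKernel (plateauMollifier d ((k : ℝ) + 2)) ℓ) x) =
      fun k : ℕ => ∫ z, mollifierKernel (plateauMollifier d ((k : ℝ) + 2)) ℓ z • θ (x + z) := by
    funext k
    rw [convolution_eq_integral_mul_translate _ _ (mollifierKernel_neg (isUnitBallMollifier_plateauMollifier (hm k)).isMollifier ℓ)]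
    rfl
  rw [hev, ← integral_ballTorusKernel_smul_translate hθ ℓ x]
  exact tendsto_integral_mollifierKernel_smul hθ hℓ x

end PlateauKernels

/-! ## The limit of the kernel fluxes: the sphere term (Novack's `γ → 0` in (DR)), from the tree -/

section SphereLimit

variable {d : Type*} [Fintype d] [DecidableEq d]
variable {T ℓ : ℝ} {u : ℝ → UnitAddTorus d → EuclideanSpace ℝ d} {ψ : ℝ → UnitAddTorus d → ℝ}

/-- **The kernel fluxes of Novack's kernels converge to the sphere term** (Novack 2024, §2 Step 1,
the passage `γ → 0` in (DR): "changing to spherical variables `y ↦ (r, σ)` … we use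
(dumber:bound) to pass to the limit"): for `u ∈ L³((0,T) × T^d)` jointly measurable, `ψ` a test
function supported in `(0,T)` and `ℓ > 0`,
`∫₀ᵀ∫ 𝒟_{K_m}(u) ψ → −(d/ℓ) ∫₀ᵀ∫ ⨍_{S^{d-1}} (δu·ω)|δu|²(ℓω) dω ψ` as `m = k + 2 → ∞`. Entirely from
the tree: `𝒟_{K_m} = 4D_ℓ^{φ_m}` slice-wise (`Torus.four_mul_duchonRobertApprox_eq_kernelFlux`),
the radial form of the Duchon–Robert pairing (`Torus.integral_duchonRobertApprox_eq_radial`), the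
un-averaging lemma at fixed scale (`Torus.tendsto_integral_pow_mul_deriv_profile_mul`, with the
shell function continuous on `(0,∞)` by `Torus.continuous_shellPairing`) and
`Torus.integral_inv_mul_energyFluxSphereAvg_eq` — the block `hA`/`hJ` of
`Torus.HasUniformDuchonRobertDefect.hasFourThirdsLaw` (`DuchonRobertUniformDefect`). [cite: Novack2024, Sect. 2 Step 1 (DR)→(capital:D:dumb)] -/
theorem tendsto_integral_kernelFlux_mollifierKernel [Nonempty d]
    (hum : AEStronglyMeasurable (uncurry u) ((volume.restrict (Ioo 0 T)).prod volume))
    (hu3 : ∫⁻ t in Ioo 0 T, ∫⁻ x, ‖u t x‖ₑ ^ 3 < ∞)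
    (hψ : FunctionSpaces.Torus.IsSpaceTimeTestIoo T ψ) (hℓ : 0 < ℓ) :
    Tendsto (fun k : ℕ => ∫ t in Ioo 0 T, ∫ x,
        kernelFlux (mollifierKernel (plateauMollifier d ((k : ℝ) + 2)) ℓ) (u t) x * ψ t x) atTop
      (𝓝 (-((Fintype.card d : ℝ) / ℓ) * ∫ t in Ioo 0 T, ∫ x, energyFluxSphereAvg (u t) ℓ x * ψ t x)) := by
  set μp : Measure (ℝ × UnitAddTorus d) := (volume.restrict (Ioo 0 T)).prod volume with hμp
  have hu3' : ∫⁻ p, ‖uncurry u p‖ₑ ^ 3 ∂μp < ∞ := by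
    have e : ∫⁻ t in Ioo 0 T, ∫⁻ x, ‖u t x‖ₑ ^ 3 = ∫⁻ p, ‖u p.1 p.2‖ₑ ^ 3 ∂μp :=
      lintegral_Ioo_lintegral_eq_lintegral_prod (hum.enorm.pow_const _)
    rwa [e] at hu3
  have hslice3 : ∀ᵐ t ∂(volume.restrict (Ioo 0 T)), MemLp (u t) 3 volume := ae_memLp_three_of_lintegral hum hu3
  obtain ⟨Cψ, hψb⟩ := hψ.exists_abs_le
  have hψm : AEStronglyMeasurable (uncurry ψ) μp := hψ.continuous_uncurry.aestronglyMeasurable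
  set n : ℕ := Fintype.card d with hndef
  set c : ℝ := (volume : Measure (EuclideanSpace ℝ d)).toSphere.real univ with hcdef
  have hc : 0 < c := toSphere_real_univ_pos
  obtain ⟨e₀, he₀⟩ : ∃ e : EuclideanSpace ℝ d, ‖e‖ = 1 := by
    obtain ⟨i⟩ := ‹Nonempty d›
    exact ⟨EuclideanSpace.single i 1, by simp⟩
  have hm : ∀ k : ℕ, (1 : ℝ) < (k : ℝ) + 2 := fun k => by
    have : (0 : ℝ) ≤ k := Nat.cast_nonneg k
    linarith
  -- the shell function `G(r) = r⁻¹ I(r)`, continuous on `(0, ∞)`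
  set G : ℝ → ℝ := fun r => r⁻¹ * energyFluxShellPairing T u ψ r with hGdef
  have hGcont : ContinuousOn G (Ioi 0) :=
    (continuousOn_inv₀.mono fun r hr => ne_of_gt hr).mul (continuous_shellPairing hum hu3' hψm hψb).continuousOn
  -- Step 1: the tested flux through the Duchon–Robert pairing, in radial form
  have key : ∀ k : ℕ, (∫ t in Ioo 0 T, ∫ x, kernelFlux (mollifierKernel (plateauMollifier d ((k : ℝ) + 2)) ℓ) (u t) x * ψ t x) =
      4 * (4⁻¹ * c * ∫ x in Ioi (0 : ℝ), x ^ n *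
        deriv (fun r : ℝ => plateauMollifier d ((k : ℝ) + 2) (r • e₀)) x * G (ℓ * x)) := by
    intro k
    have hφ := isUnitBallMollifier_plateauMollifier (d := d) (hm k)
    rw [← integral_duchonRobertApprox_eq_radial hφ (fun x y hxy => plateauMollifier_radial _ hxy) he₀
      hum hu3' hψm hψb hℓ, ← integral_const_mul]
    refine integral_congr_ae (hslice3.mono fun t ht => ?_)
    dsimp only
    rw [← integral_const_mul]
    refine integral_congr_ae (ae_of_all _ fun x => ?_)
    dsimp only
    rw [← four_mul_duchonRobertApprox_eq_kernelFlux hφ.isMollifier hℓ ht x]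
    ring
  -- Step 2: the un-averaging limit at fixed scale `ℓ`
  have hJ := tendsto_integral_pow_mul_deriv_profile_mul (d := d) he₀ hGcont hℓ
  have hlim : Tendsto (fun k : ℕ => 4 * (4⁻¹ * c * ∫ x in Ioi (0 : ℝ), x ^ n *
        deriv (fun r : ℝ => plateauMollifier d ((k : ℝ) + 2) (r • e₀)) x * G (ℓ * x))) atTop
      (𝓝 (4 * (4⁻¹ * c * (-(n : ℝ) / c * G ℓ)))) := (hJ.const_mul (4⁻¹ * c)).const_mul 4
  -- Step 3: the value of the limit
  have hGℓ : ∫ t in Ioo 0 T, ∫ x, energyFluxSphereAvg (u t) ℓ x * ψ t x = ℓ * G ℓ := by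
    have h := integral_inv_mul_energyFluxSphereAvg_eq hum hu3' hψm hψb ℓ
    have e : (∫ t in Ioo 0 T, ∫ x, ℓ⁻¹ * energyFluxSphereAvg (u t) ℓ x * ψ t x) =
        ℓ⁻¹ * ∫ t in Ioo 0 T, ∫ x, energyFluxSphereAvg (u t) ℓ x * ψ t x := by
      rw [← integral_const_mul]
      refine integral_congr_ae (ae_of_all _ fun t => ?_)
      dsimp only
      rw [← integral_const_mul]
      refine integral_congr_ae (ae_of_all _ fun x => ?_)
      dsimp only
      ring
    rw [e] at h
    have hX : (∫ t in Ioo 0 T, ∫ x, energyFluxSphereAvg (u t) ℓ x * ψ t x) = energyFluxShellPairing T u ψ ℓ :=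
      mul_left_cancel₀ (inv_ne_zero hℓ.ne') h
    rw [hX, hGdef]
    dsimp only
    rw [← mul_assoc, mul_inv_cancel₀ hℓ.ne', one_mul]
  have hval : 4 * (4⁻¹ * c * (-(n : ℝ) / c * G ℓ)) =
      -((Fintype.card d : ℝ) / ℓ) * ∫ t in Ioo 0 T, ∫ x, energyFluxSphereAvg (u t) ℓ x * ψ t x := by
    rw [hGℓ, hndef]
    field_simp
  rw [← hval]
  exact hlim.congr fun k => (key k).symm

end SphereLimit

/-! ## The limit of the kernel pairings: the ball-averaged pairing -/

section BallLimit

variable {d : Type*} [Fintype d] [DecidableEq d]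
variable {T ℓ : ℝ} {u : ℝ → UnitAddTorus d → EuclideanSpace ℝ d} {p : ℝ → UnitAddTorus d → ℝ}
  {ψ : ℝ → UnitAddTorus d → ℝ}

omit [DecidableEq d] in
/-- **Dominated convergence for iterated space–time pairings along a sequence**: if the
integrands `Fₙ` are jointly measurable and dominated by an integrable function on `(0,T) × T^d`,
and converge a.e., then `∫₀ᵀ∫ Fₙ → ∫₀ᵀ∫ F₀` (Fubini; the limit is jointly measurable as an a.e.
limit). [folklore] -/
theorem tendsto_integral_Ioo_integral_of_dominated {F : ℕ → ℝ → UnitAddTorus d → ℝ}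
    {F₀ : ℝ → UnitAddTorus d → ℝ} {bound : ℝ × UnitAddTorus d → ℝ}
    (hmeas : ∀ n, AEStronglyMeasurable (uncurry (F n)) ((volume.restrict (Ioo 0 T)).prod volume))
    (hbound : ∀ n, ∀ᵐ z ∂((volume.restrict (Ioo 0 T)).prod volume), ‖F n z.1 z.2‖ ≤ bound z)
    (hint : Integrable bound ((volume.restrict (Ioo 0 T)).prod volume))
    (hlim : ∀ᵐ z ∂((volume.restrict (Ioo 0 T)).prod volume),
      Tendsto (fun n => F n z.1 z.2) atTop (𝓝 (F₀ z.1 z.2))) :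
    Tendsto (fun n => ∫ t in Ioo 0 T, ∫ x, F n t x) atTop (𝓝 (∫ t in Ioo 0 T, ∫ x, F₀ t x)) := by
  set μp : Measure (ℝ × UnitAddTorus d) := (volume.restrict (Ioo 0 T)).prod volume with hμp
  -- the limit is jointly measurable and dominated
  have hF₀m : AEStronglyMeasurable (uncurry F₀) μp :=
    aestronglyMeasurable_of_tendsto_ae atTop (f := fun n => uncurry (F n)) hmeas hlim
  have hF₀b : ∀ᵐ z ∂μp, ‖F₀ z.1 z.2‖ ≤ bound z := by
    have hall : ∀ᵐ z ∂μp, ∀ n, ‖F n z.1 z.2‖ ≤ bound z := ae_all_iff.2 hbound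
    filter_upwards [hall, hlim] with z hz hzl
    exact le_of_tendsto' ((continuous_norm.tendsto _).comp hzl) hz
  have hF₀i : Integrable (uncurry F₀) μp := hint.mono' hF₀m hF₀b
  -- dominated convergence on the product, read as iterated integrals
  have hmain : Tendsto (fun n => ∫ z, F n z.1 z.2 ∂μp) atTop (𝓝 (∫ z, F₀ z.1 z.2 ∂μp)) :=
    tendsto_integral_of_dominated_convergence bound hmeas hint hbound hlim
  have hev : ∀ n, ∫ z, F n z.1 z.2 ∂μp = ∫ t in Ioo 0 T, ∫ x, F n t x := fun n =>
    integral_prod (uncurry (F n)) (hint.mono' (hmeas n) (hbound n))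
  have e : ∫ z, F₀ z.1 z.2 ∂μp = ∫ t in Ioo 0 T, ∫ x, F₀ t x := integral_prod (uncurry F₀) hF₀i
  rw [e] at hmain
  exact hmain.congr hev

omit [DecidableEq d] in
/-- The slice domination `(t,x) ↦ (∫|u(t)|) |u(t,x)|` is integrable on `(0,T) × T^d` for
`u ∈ L³_{t,x}` (indeed `L²`; Jensen in the slice). [folklore] -/
theorem integrable_sliceNorm_mul_norm
    (hum : AEStronglyMeasurable (uncurry u) ((volume.restrict (Ioo 0 T)).prod volume))
    (hu3 : ∫⁻ t in Ioo 0 T, ∫⁻ x, ‖u t x‖ₑ ^ 3 < ⊤) :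
    Integrable (fun z : ℝ × UnitAddTorus d => (∫ y, ‖u z.1 y‖) * ‖u z.1 z.2‖)
      ((volume.restrict (Ioo 0 T)).prod volume) := by
  set μ : Measure ℝ := volume.restrict (Ioo 0 T) with hμ
  set μT := μ.prod (volume : Measure (UnitAddTorus d)) with hμT
  have hslice : ∀ᵐ t ∂μ, AEStronglyMeasurable (u t) volume := hum.prodMk_left
  have hN1 : AEStronglyMeasurable (fun t => ∫ y, ‖u t y‖) μ := hum.norm.integral_prod_right'
  have h2fin : ∫⁻ t in Ioo 0 T, ∫⁻ x, ‖u t x‖ₑ ^ 2 < ⊤ :=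
    lt_of_le_of_lt (lintegral_enorm_sq_le hum) (ENNReal.mul_lt_top
      (ENNReal.rpow_lt_top_of_nonneg (by norm_num) ENNReal.ofReal_ne_top)
      (ENNReal.rpow_lt_top_of_nonneg (by norm_num) hu3.ne))
  refine ⟨(hN1.comp_fst).mul hum.norm, ?_⟩
  have hmeas : AEMeasurable (fun z : ℝ × UnitAddTorus d => ‖∫ y, ‖u z.1 y‖‖ₑ * ‖u z.1 z.2‖ₑ) μT :=
    (hN1.comp_fst).enorm.mul hum.enorm
  have hg1 : ∀ t, ‖∫ y, ‖u t y‖‖ₑ ≤ ∫⁻ y, ‖u t y‖ₑ := fun t =>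
    (enorm_integral_le_lintegral_enorm _).trans (le_of_eq (lintegral_congr fun y => enorm_norm _))
  calc ∫⁻ z, ‖(∫ y, ‖u z.1 y‖) * ‖u z.1 z.2‖‖ₑ ∂μT
      = ∫⁻ z, ‖∫ y, ‖u z.1 y‖‖ₑ * ‖u z.1 z.2‖ₑ ∂μT := by
        refine lintegral_congr fun z => ?_
        rw [enorm_mul, enorm_norm]
    _ = ∫⁻ t, ‖∫ y, ‖u t y‖‖ₑ * (∫⁻ x, ‖u t x‖ₑ) ∂μ := by
        rw [lintegral_prod _ hmeas]
        refine lintegral_congr_ae (hslice.mono fun t ht => ?_)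
        show ∫⁻ y, ‖∫ y', ‖u t y'‖‖ₑ * ‖u t y‖ₑ = _
        exact lintegral_const_mul'' _ ht.enorm
    _ ≤ ∫⁻ t, (∫⁻ x, ‖u t x‖ₑ ^ 2) ∂μ := by
        refine lintegral_mono_ae (hslice.mono fun t ht => ?_)
        calc ‖∫ y, ‖u t y‖‖ₑ * (∫⁻ x, ‖u t x‖ₑ) ≤ (∫⁻ x, ‖u t x‖ₑ) * (∫⁻ x, ‖u t x‖ₑ) :=
              mul_le_mul' (hg1 t) le_rfl
          _ = (∫⁻ x, ‖u t x‖ₑ) ^ (2 : ℝ) := by rw [ENNReal.rpow_two, sq]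
          _ ≤ ∫⁻ x, ‖u t x‖ₑ ^ (2 : ℝ) := lintegral_enorm_rpow_le ht (by norm_num)
          _ = ∫⁻ x, ‖u t x‖ₑ ^ 2 := by simp_rw [ENNReal.rpow_two]
    _ < ⊤ := h2fin

/-- **The kernel pairings converge to the ball-averaged pairing** (Novack 2024, §2 Step 1:
"We first pass to the limit [`γ → 0`] in every term from (last:one) except the very last term
…, using the integrability assumptions on all involved quantities and the dominated convergence
theorem"): for `u ∈ L³((0,T) × T^d)`, `p ∈ L^{3/2}((0,T) × T^d)` jointly measurable, a test
function `ψ` supported in `(0,T)` and `ℓ > 0`,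
`𝒩[K_m](ψ) → 𝒩_ℓ(ψ)` as `m = k + 2 → ∞` (`Torus.novackKernelPairing` → `Torus.novackBallPairing`),
`K_m = mollifierKernel (plateauMollifier d m) ℓ`: the torus kernels are uniformly bounded and
converge pointwise to the periodised ball kernel, so that `f ⋆ K_m → f^ℓ` pointwise for every
integrable slice (`tendsto_vecConv_mollifierKernel`), with the slice-norm dominations
`(∫|u(t)|)|u|`, `(∫|u(t)|)|u|²`, `∫|u(t)|³`, `(∫|u(t)|²)|u|`, `|p| ∫|u(t)|`, `(∫|p(t)|)|u|`. [cite: Novack2024, Sect. 2 Step 1, limit γ → 0 in (last:one)] -/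
theorem tendsto_novackKernelPairing_mollifierKernel [Nonempty d]
    (hum : AEStronglyMeasurable (uncurry u) ((volume.restrict (Ioo 0 T)).prod volume))
    (hu3 : ∫⁻ t in Ioo 0 T, ∫⁻ x, ‖u t x‖ₑ ^ 3 < ⊤)
    (hpm : AEStronglyMeasurable (uncurry p) ((volume.restrict (Ioo 0 T)).prod volume))
    (hp : ∫⁻ t in Ioo 0 T, ∫⁻ x, ‖p t x‖ₑ ^ (3 / 2 : ℝ) < ⊤)
    (hψ : FunctionSpaces.Torus.IsSpaceTimeTestIoo T ψ) (hℓ : 0 < ℓ) :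
    Tendsto (fun k : ℕ => novackKernelPairing T u p ψ (mollifierKernel (plateauMollifier d ((k : ℝ) + 2)) ℓ)) atTop
      (𝓝 (novackBallPairing T u p ψ ℓ)) := by
  set μ : Measure ℝ := volume.restrict (Ioo 0 T) with hμ
  set μT := μ.prod (volume : Measure (UnitAddTorus d)) with hμT
  -- test-field data
  obtain ⟨-, hdt, hgr, -⟩ := hψ.isSpaceTimeTest.isSmoothSpaceTimeOn_derived
  obtain ⟨⟨Cdt, hCdt0, hCdt⟩, hdtm⟩ := hdt.bound_and_measurable T
  obtain ⟨⟨Cg, hCg0, hCg⟩, hgm⟩ := hgr.bound_and_measurable T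
  -- the uniform kernel bound and the continuity of the kernels
  obtain ⟨n, hn⟩ := exists_nat_ge (ℓ + Fintype.card d)
  set CK : ℝ := (FunctionSpaces.Torus.latticeWindow d n).card *
    ((ℓ ^ Fintype.card d)⁻¹ * (∫ η : EuclideanSpace ℝ d, plateauBump 2 η)⁻¹) with hCK
  have hCK0 : 0 ≤ CK := by
    have : 0 ≤ ∫ η : EuclideanSpace ℝ d, plateauBump 2 η := integral_nonneg fun η => plateauBump_nonneg _ _
    positivity
  have hm1 : ∀ k : ℕ, (1 : ℝ) < (k : ℝ) + 2 := fun k => by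
    have : (0 : ℝ) ≤ k := Nat.cast_nonneg k
    linarith
  set Kk : ℕ → UnitAddTorus d → ℝ := fun k => mollifierKernel (plateauMollifier d ((k : ℝ) + 2)) ℓ with hKk
  have hKb : ∀ (k : ℕ) z, ‖Kk k z‖ ≤ CK := fun k z => by
    rw [Real.norm_eq_abs]
    exact abs_mollifierKernel_plateauMollifier_le hℓ (by have : (0 : ℝ) ≤ k := Nat.cast_nonneg k; linarith) hn z
  have hKc : ∀ k : ℕ, Continuous (Kk k) := fun k =>
    (isSmooth_mollifierKernel (isUnitBallMollifier_plateauMollifier (hm1 k)).isMollifier hℓ).continuous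
  -- a.e. data on the product
  have hIoo : ∀ᵐ z ∂μT, z.1 ∈ Ioo 0 T := by
    rw [hμT, hμ, ← volume_restrict_Ioo_prod_univ]
    filter_upwards [ae_restrict_mem (measurableSet_Ioo.prod MeasurableSet.univ)] with z hz
    exact hz.1
  have hU3 : ∫⁻ z, ‖u z.1 z.2‖ₑ ^ (3 : ℝ) ∂μT < ⊤ := by
    have e : ∫⁻ t in Ioo 0 T, ∫⁻ x, ‖u t x‖ₑ ^ (3 : ℝ) = ∫⁻ z, ‖u z.1 z.2‖ₑ ^ (3 : ℝ) ∂μT :=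
      lintegral_Ioo_lintegral_eq_lintegral_prod (hum.enorm.pow_const _)
    rw [← e]
    simpa only [ENNReal.rpow_ofNat] using hu3
  have hP32 : ∫⁻ z, ‖p z.1 z.2‖ₑ ^ (3 / 2 : ℝ) ∂μT < ⊤ := by
    have e : ∫⁻ t in Ioo 0 T, ∫⁻ x, ‖p t x‖ₑ ^ (3 / 2 : ℝ) = ∫⁻ z, ‖p z.1 z.2‖ₑ ^ (3 / 2 : ℝ) ∂μT :=
      lintegral_Ioo_lintegral_eq_lintegral_prod (hpm.enorm.pow_const _)
    rwa [← e]
  have hslice3 : ∀ᵐ t ∂μ, MemLp (u t) 3 volume := ae_memLp_three_of_lintegral hum hu3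
  have hp1 : ∀ᵐ t ∂μ, Integrable (p t) volume := by
    have h32 := FunctionSpaces.Torus.ae_memLp_of_lintegral_prod_rpow_lt_top hpm
      (by norm_num : (0:ℝ) < 3 / 2) hP32
    filter_upwards [h32] with t ht
    exact ht.integrable (by rw [← ENNReal.ofReal_one]; exact ENNReal.ofReal_le_ofReal (by norm_num))
  have hgood : ∀ᵐ z ∂μT, MemLp (u z.1) 3 volume ∧ Integrable (p z.1) volume :=
    ae_prod_of_ae_left ((hslice3.and hp1).mono fun t ht => fun _ => ht)
  -- dominations
  obtain ⟨D1, D2, D3⟩ := integrable_slice_dominations hum hu3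
  have D0 := integrable_sliceNorm_mul_norm hum hu3
  have D5 := integrable_pressure_mul_sliceNorm hum hu3 hpm hp
  have D6 := integrable_sliceNorm_pressure_mul hum hu3 hpm hp
  -- measurability of the auxiliary fields
  have hG2 : AEStronglyMeasurable (uncurry fun t y => ‖u t y‖ ^ 2 • u t y) μT := (hum.norm.pow 2).smul hum
  have hΘ : AEStronglyMeasurable (uncurry fun t y => ‖u t y‖ ^ 2) μT := hum.norm.pow 2
  -- pointwise facts at good points
  have hnorm3 : ∀ v : UnitAddTorus d → EuclideanSpace ℝ d, ∫ y, ‖‖v y‖ ^ 2 • v y‖ = ∫ y, ‖v y‖ ^ 3 := fun v =>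
    integral_congr_ae (ae_of_all _ fun y => by
      dsimp only; rw [norm_smul, Real.norm_eq_abs, abs_of_nonneg (sq_nonneg _)]; ring)
  have hnorm2 : ∀ v : UnitAddTorus d → EuclideanSpace ℝ d, ∫ y, ‖‖v y‖ ^ 2‖ = ∫ y, ‖v y‖ ^ 2 := fun v =>
    integral_congr_ae (ae_of_all _ fun y => by
      dsimp only; rw [Real.norm_eq_abs, abs_of_nonneg (sq_nonneg _)])
  have hiG : ∀ v : UnitAddTorus d → EuclideanSpace ℝ d, MemLp v 3 volume →
      Integrable (fun y => ‖v y‖ ^ 2 • v y) volume := fun v hv => by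
    obtain ⟨I3t, -, -⟩ := MemLp.integrable_norm_pow_three_and_sq hv
    refine I3t.mono' ((hv.1.norm.pow 2).smul hv.1) (ae_of_all _ fun y => le_of_eq ?_)
    rw [norm_smul, Real.norm_eq_abs, abs_of_nonneg (sq_nonneg _)]
    ring
  -- the inner-product weight
  have hi : ∀ᵐ z ∂μT, ‖⟪u z.1 z.2, FunctionSpaces.Torus.gradient (ψ z.1) z.2⟫‖ ≤ ‖u z.1 z.2‖ * Cg := by
    filter_upwards [hIoo] with z hz
    exact (norm_inner_le_norm _ _).trans
      (mul_le_mul_of_nonneg_left (hCg z.1 (Ioo_subset_Icc_self hz) z.2) (norm_nonneg _))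
  -- Term 1: `⟪u, u ⋆ K⟫ ∂ₜψ`
  have hT1 : Tendsto (fun k : ℕ => ∫ t in Ioo 0 T, ∫ x,
      ⟪u t x, vecConv (u t) (Kk k) x⟫ * FunctionSpaces.Torus.timeDeriv ψ t x) atTop
      (𝓝 (∫ t in Ioo 0 T, ∫ x, ⟪u t x, ballAvg (u t) ℓ x⟫ * FunctionSpaces.Torus.timeDeriv ψ t x)) := by
    refine tendsto_integral_Ioo_integral_of_dominated
      (F := fun k t x => ⟪u t x, vecConv (u t) (Kk k) x⟫ * FunctionSpaces.Torus.timeDeriv ψ t x)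
      (F₀ := fun t x => ⟪u t x, ballAvg (u t) ℓ x⟫ * FunctionSpaces.Torus.timeDeriv ψ t x)
      (bound := fun z => Fintype.card d * CK * Cdt * ((∫ y, ‖u z.1 y‖) * ‖u z.1 z.2‖)) ?_ ?_
      (D0.const_mul _) ?_
    · exact fun k => (hum.inner (aestronglyMeasurable_uncurry_vecConv hum (hKc k))).mul hdtm
    · intro k
      filter_upwards [hIoo, hgood] with z hz hzg
      have hv := norm_vecConv_le (hzg.1.integrable (by norm_num)) (hKb k) z.2
      have hN0 : 0 ≤ ∫ y, ‖u z.1 y‖ := integral_nonneg fun y => norm_nonneg _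
      rw [norm_mul]
      calc ‖⟪u z.1 z.2, vecConv (u z.1) (Kk k) z.2⟫‖ * ‖FunctionSpaces.Torus.timeDeriv ψ z.1 z.2‖
          ≤ (‖u z.1 z.2‖ * (Fintype.card d * (CK * ∫ y, ‖u z.1 y‖))) * Cdt :=
            mul_le_mul ((norm_inner_le_norm _ _).trans (mul_le_mul_of_nonneg_left hv (norm_nonneg _)))
              (hCdt z.1 (Ioo_subset_Icc_self hz) z.2) (norm_nonneg _) (by positivity)
        _ = Fintype.card d * CK * Cdt * ((∫ y, ‖u z.1 y‖) * ‖u z.1 z.2‖) := by ring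
    · filter_upwards [hgood] with z hzg
      exact (tendsto_const_nhds.inner
        (tendsto_vecConv_mollifierKernel (hzg.1.integrable (by norm_num)) hℓ z.2)).mul_const _
  -- Term 2: `⟪u, u ⋆ K⟫ ⟪u, ∇ψ⟫`
  have hT2 : Tendsto (fun k : ℕ => ∫ t in Ioo 0 T, ∫ x,
      ⟪u t x, vecConv (u t) (Kk k) x⟫ * ⟪u t x, FunctionSpaces.Torus.gradient (ψ t) x⟫)
      atTop
      (𝓝 (∫ t in Ioo 0 T, ∫ x, ⟪u t x, ballAvg (u t) ℓ x⟫ * ⟪u t x, FunctionSpaces.Torus.gradient (ψ t) x⟫)) := by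
    refine tendsto_integral_Ioo_integral_of_dominated
      (F := fun k t x => ⟪u t x, vecConv (u t) (Kk k) x⟫ *
        ⟪u t x, FunctionSpaces.Torus.gradient (ψ t) x⟫)
      (F₀ := fun t x => ⟪u t x, ballAvg (u t) ℓ x⟫ * ⟪u t x, FunctionSpaces.Torus.gradient (ψ t) x⟫)
      (bound := fun z => Fintype.card d * CK * Cg * ((∫ y, ‖u z.1 y‖) * ‖u z.1 z.2‖ ^ 2)) ?_ ?_
      (D3.const_mul _) ?_
    · exact fun k => (hum.inner (aestronglyMeasurable_uncurry_vecConv hum (hKc k))).mul (hum.inner hgm)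
    · intro k
      filter_upwards [hi, hgood] with z hzi hzg
      have hv := norm_vecConv_le (hzg.1.integrable (by norm_num)) (hKb k) z.2
      have hN0 : 0 ≤ ∫ y, ‖u z.1 y‖ := integral_nonneg fun y => norm_nonneg _
      rw [norm_mul]
      calc ‖⟪u z.1 z.2, vecConv (u z.1) (Kk k) z.2⟫‖ *
            ‖⟪u z.1 z.2, FunctionSpaces.Torus.gradient (ψ z.1) z.2⟫‖
          ≤ (‖u z.1 z.2‖ * (Fintype.card d * (CK * ∫ y, ‖u z.1 y‖))) * (‖u z.1 z.2‖ * Cg) :=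
            mul_le_mul ((norm_inner_le_norm _ _).trans (mul_le_mul_of_nonneg_left hv (norm_nonneg _)))
              hzi (norm_nonneg _) (by positivity)
        _ = Fintype.card d * CK * Cg * ((∫ y, ‖u z.1 y‖) * ‖u z.1 z.2‖ ^ 2) := by ring
    · filter_upwards [hgood] with z hzg
      exact (tendsto_const_nhds.inner
        (tendsto_vecConv_mollifierKernel (hzg.1.integrable (by norm_num)) hℓ z.2)).mul_const _
  -- Term 3: `⟪(|u|²u) ⋆ K, ∇ψ⟫`
  have hT3 : Tendsto (fun k : ℕ => ∫ t in Ioo 0 T, ∫ x,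
      ⟪vecConv (fun y => ‖u t y‖ ^ 2 • u t y) (Kk k) x, FunctionSpaces.Torus.gradient (ψ t) x⟫)
      atTop
      (𝓝 (∫ t in Ioo 0 T, ∫ x,
        ⟪ballAvg (fun y => ‖u t y‖ ^ 2 • u t y) ℓ x, FunctionSpaces.Torus.gradient (ψ t) x⟫)) := by
    refine tendsto_integral_Ioo_integral_of_dominated
      (F := fun k t x => ⟪vecConv (fun y => ‖u t y‖ ^ 2 • u t y) (Kk k) x,
        FunctionSpaces.Torus.gradient (ψ t) x⟫)
      (F₀ := fun t x => ⟪ballAvg (fun y => ‖u t y‖ ^ 2 • u t y) ℓ x, FunctionSpaces.Torus.gradient (ψ t) x⟫)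
      (bound := fun z => Fintype.card d * CK * Cg * ∫ y, ‖u z.1 y‖ ^ 3) ?_ ?_ (D1.const_mul _) ?_
    · exact fun k => (aestronglyMeasurable_uncurry_vecConv hG2 (hKc k)).inner hgm
    · intro k
      filter_upwards [hIoo, hgood] with z hz hzg
      have hv := norm_vecConv_le (hiG _ hzg.1) (hKb k) z.2
      rw [hnorm3] at hv
      calc ‖⟪vecConv (fun y => ‖u z.1 y‖ ^ 2 • u z.1 y) (Kk k) z.2,
              FunctionSpaces.Torus.gradient (ψ z.1) z.2⟫‖
          ≤ ‖vecConv (fun y => ‖u z.1 y‖ ^ 2 • u z.1 y) (Kk k) z.2‖ *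
              ‖FunctionSpaces.Torus.gradient (ψ z.1) z.2‖ := norm_inner_le_norm _ _
        _ ≤ (Fintype.card d * (CK * ∫ y, ‖u z.1 y‖ ^ 3)) * Cg :=
            mul_le_mul hv (hCg z.1 (Ioo_subset_Icc_self hz) z.2) (norm_nonneg _) (by positivity)
        _ = Fintype.card d * CK * Cg * ∫ y, ‖u z.1 y‖ ^ 3 := by ring
    · filter_upwards [hgood] with z hzg
      exact (tendsto_vecConv_mollifierKernel (hiG _ hzg.1) hℓ z.2).inner tendsto_const_nhds
  -- Term 4: `(|u|² ⋆ K) ⟪u, ∇ψ⟫`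
  have hT4 : Tendsto (fun k : ℕ => ∫ t in Ioo 0 T, ∫ x,
      ((fun y => ‖u t y‖ ^ 2) ⋆ Kk k) x * ⟪u t x, FunctionSpaces.Torus.gradient (ψ t) x⟫)
      atTop
      (𝓝 (∫ t in Ioo 0 T, ∫ x,
        ballAvg (fun y => ‖u t y‖ ^ 2) ℓ x * ⟪u t x, FunctionSpaces.Torus.gradient (ψ t) x⟫)) := by
    refine tendsto_integral_Ioo_integral_of_dominated
      (F := fun k t x => ((fun y => ‖u t y‖ ^ 2) ⋆ Kk k) x *
        ⟪u t x, FunctionSpaces.Torus.gradient (ψ t) x⟫)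
      (F₀ := fun t x => ballAvg (fun y => ‖u t y‖ ^ 2) ℓ x * ⟪u t x, FunctionSpaces.Torus.gradient (ψ t) x⟫)
      (bound := fun z => CK * Cg * ((∫ y, ‖u z.1 y‖ ^ 2) * ‖u z.1 z.2‖)) ?_ ?_ (D2.const_mul _) ?_
    · exact fun k => (FunctionSpaces.Torus.aestronglyMeasurable_uncurry_convolution (ContinuousLinearMap.lsmul ℝ ℝ)
        hΘ (hKc k)).mul (hum.inner hgm)
    · intro k
      filter_upwards [hi, hgood] with z hzi hzg
      obtain ⟨-, I2t, -⟩ := MemLp.integrable_norm_pow_three_and_sq hzg.1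
      have hconv : ‖((fun y => ‖u z.1 y‖ ^ 2) ⋆ Kk k) z.2‖ ≤ CK * ∫ y, ‖u z.1 y‖ ^ 2 := by
        have h := FunctionSpaces.Torus.norm_convolution_le I2t (hKb k) z.2
        rwa [hnorm2] at h
      have hN0 : 0 ≤ ∫ y, ‖u z.1 y‖ ^ 2 := integral_nonneg fun y => sq_nonneg _
      rw [norm_mul]
      calc ‖((fun y => ‖u z.1 y‖ ^ 2) ⋆ Kk k) z.2‖ *
            ‖⟪u z.1 z.2, FunctionSpaces.Torus.gradient (ψ z.1) z.2⟫‖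
          ≤ (CK * ∫ y, ‖u z.1 y‖ ^ 2) * (‖u z.1 z.2‖ * Cg) := mul_le_mul hconv hzi (norm_nonneg _) (by positivity)
        _ = CK * Cg * ((∫ y, ‖u z.1 y‖ ^ 2) * ‖u z.1 z.2‖) := by ring
    · filter_upwards [hgood] with z hzg
      obtain ⟨-, I2t, -⟩ := MemLp.integrable_norm_pow_three_and_sq hzg.1
      exact (tendsto_convolution_mollifierKernel I2t hℓ z.2).mul_const _
  -- Term 5: `p ⟪u ⋆ K, ∇ψ⟫`
  have hT5 : Tendsto (fun k : ℕ => ∫ t in Ioo 0 T, ∫ x,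
      p t x * ⟪vecConv (u t) (Kk k) x, FunctionSpaces.Torus.gradient (ψ t) x⟫) atTop
      (𝓝 (∫ t in Ioo 0 T, ∫ x, p t x * ⟪ballAvg (u t) ℓ x, FunctionSpaces.Torus.gradient (ψ t) x⟫)) := by
    refine tendsto_integral_Ioo_integral_of_dominated
      (F := fun k t x => p t x * ⟪vecConv (u t) (Kk k) x, FunctionSpaces.Torus.gradient (ψ t) x⟫)
      (F₀ := fun t x => p t x * ⟪ballAvg (u t) ℓ x, FunctionSpaces.Torus.gradient (ψ t) x⟫)
      (bound := fun z => Fintype.card d * CK * Cg * (‖p z.1 z.2‖ * ∫ y, ‖u z.1 y‖)) ?_ ?_ (D5.const_mul _) ?_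
    · exact fun k => hpm.mul ((aestronglyMeasurable_uncurry_vecConv hum (hKc k)).inner hgm)
    · intro k
      filter_upwards [hIoo, hgood] with z hz hzg
      have hv := norm_vecConv_le (hzg.1.integrable (by norm_num)) (hKb k) z.2
      have hN0 : 0 ≤ ∫ y, ‖u z.1 y‖ := integral_nonneg fun y => norm_nonneg _
      rw [norm_mul]
      calc ‖p z.1 z.2‖ * ‖⟪vecConv (u z.1) (Kk k) z.2, FunctionSpaces.Torus.gradient (ψ z.1) z.2⟫‖
          ≤ ‖p z.1 z.2‖ * ((Fintype.card d * (CK * ∫ y, ‖u z.1 y‖)) * Cg) := by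
            refine mul_le_mul_of_nonneg_left ?_ (norm_nonneg _)
            exact (norm_inner_le_norm _ _).trans
              (mul_le_mul hv (hCg z.1 (Ioo_subset_Icc_self hz) z.2) (norm_nonneg _) (by positivity))
        _ = Fintype.card d * CK * Cg * (‖p z.1 z.2‖ * ∫ y, ‖u z.1 y‖) := by ring
    · filter_upwards [hgood] with z hzg
      exact ((tendsto_vecConv_mollifierKernel (hzg.1.integrable (by norm_num)) hℓ z.2).inner
        tendsto_const_nhds).const_mul _
  -- Term 6: `(p ⋆ K) ⟪u, ∇ψ⟫`
  have hT6 : Tendsto (fun k : ℕ => ∫ t in Ioo 0 T, ∫ x,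
      (p t ⋆ Kk k) x * ⟪u t x, FunctionSpaces.Torus.gradient (ψ t) x⟫) atTop
      (𝓝 (∫ t in Ioo 0 T, ∫ x, ballAvg (p t) ℓ x * ⟪u t x, FunctionSpaces.Torus.gradient (ψ t) x⟫)) := by
    refine tendsto_integral_Ioo_integral_of_dominated
      (F := fun k t x => (p t ⋆ Kk k) x * ⟪u t x, FunctionSpaces.Torus.gradient (ψ t) x⟫)
      (F₀ := fun t x => ballAvg (p t) ℓ x * ⟪u t x, FunctionSpaces.Torus.gradient (ψ t) x⟫)
      (bound := fun z => CK * Cg * ((∫ y, ‖p z.1 y‖) * ‖u z.1 z.2‖)) ?_ ?_ (D6.const_mul _) ?_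
    · exact fun k => (FunctionSpaces.Torus.aestronglyMeasurable_uncurry_convolution (ContinuousLinearMap.lsmul ℝ ℝ)
        hpm (hKc k)).mul (hum.inner hgm)
    · intro k
      filter_upwards [hi, hgood] with z hzi hzg
      have hconv : ‖(p z.1 ⋆ Kk k) z.2‖ ≤ CK * ∫ y, ‖p z.1 y‖ :=
        FunctionSpaces.Torus.norm_convolution_le hzg.2 (hKb k) z.2
      have hN0 : 0 ≤ ∫ y, ‖p z.1 y‖ := integral_nonneg fun y => norm_nonneg _
      rw [norm_mul]
      calc ‖(p z.1 ⋆ Kk k) z.2‖ * ‖⟪u z.1 z.2, FunctionSpaces.Torus.gradient (ψ z.1) z.2⟫‖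
          ≤ (CK * ∫ y, ‖p z.1 y‖) * (‖u z.1 z.2‖ * Cg) := mul_le_mul hconv hzi (norm_nonneg _) (by positivity)
        _ = CK * Cg * ((∫ y, ‖p z.1 y‖) * ‖u z.1 z.2‖) := by ring
    · filter_upwards [hgood] with z hzg
      exact (tendsto_convolution_mollifierKernel hzg.2 hℓ z.2).mul_const _
  -- assembly
  have h := (((((hT1.const_mul 2).add (hT2.const_mul 2)).add hT3).sub hT4).add (hT5.const_mul 2)).add
    (hT6.const_mul 2)
  exact h

end BallLimit

/-! ## Assembly: Novack's ball-averaged balance -/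

section Assembly

variable {d : Type*} [Fintype d]

/-- **Novack 2024, §2 Step 1, (eq:main:balance) with the ball kernel (`γ = 0`)**, reduced to the
tested momentum equation: granted Duchon–Robert's "(NS)·u^ε + (NS^ε)·u"
(`Torus.IsDistributionalNSSolutionOn.symmTestField_identity`, Novack's (eq:1) + (eq:2), justified
in Step 0 by "`∂ₜu_{ℓ,γ}` is a bounded linear functional on `L³ ∩ C⁰L²`"; discharged in the tree,
`Torus.symmTestField_identity_holds`), the named fact `Torus.novack2024_ballAvg_balance` holds:
for every `m = k + 2` the scale balance with the smooth radial kernel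
`K_m = mollifierKernel (plateauMollifier d m) ℓ` reads `𝒩[K_m](ψ) = ∫₀ᵀ∫ 𝒟_{K_m}(u) ψ`
(`novackKernelPairing_eq_integral_kernelFlux`), and as `k → ∞` the left side tends to `𝒩_ℓ(ψ)`
(`tendsto_novackKernelPairing_mollifierKernel`) while the right side tends to
`−(d/ℓ) ∫₀ᵀ∫ ⨍ (δu·ω)|δu|²(ℓω) dω ψ` (`tendsto_integral_kernelFlux_mollifierKernel`); limits
along `atTop` are unique. (The hypotheses `u ∈ C⁰_t L²_x`, `u₀ ∈ L²`, `ℓ < 1/2` of the fact are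
not needed for this identity.) [cite: Novack2024, Sect. 2 Step 1 (eq:main:balance) with γ = 0] -/
theorem novack2024_ballAvg_balance_of_symmTestField_identity
    (hEq : ∀ [DecidableEq d], IsDistributionalNSSolutionOn.symmTestField_identity (d := d)) :
    novack2024_ballAvg_balance (d := d) := by
  intro _ T u₀ u p hd _ hsol _ hu3 hp _ ℓ hℓ _ ψ hψ
  haveI : Nonempty d := Fintype.card_pos_iff.1 (by omega)
  have hdist : IsDistributionalNSSolutionOn T 0 0 u p := hsol.isDistributionalNSSolutionOn
  have hum : AEStronglyMeasurable (uncurry u) ((volume.restrict (Ioo 0 T)).prod volume) :=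
    aestronglyMeasurable_uncurry_prod hsol.1
  have hpm : AEStronglyMeasurable (uncurry p) ((volume.restrict (Ioo 0 T)).prod volume) :=
    aestronglyMeasurable_uncurry_prod hsol.2.2.1
  have hm1 : ∀ k : ℕ, (1 : ℝ) < (k : ℝ) + 2 := fun k => by
    have : (0 : ℝ) ≤ k := Nat.cast_nonneg k
    linarith
  -- the two limits along `k → ∞`
  have hL := tendsto_novackKernelPairing_mollifierKernel hum hu3 hpm hp hψ hℓ
  have hR := tendsto_integral_kernelFlux_mollifierKernel hum hu3 hψ hℓ
  -- the balance for the smooth kernels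
  have hev : ∀ k : ℕ, novackKernelPairing T u p ψ (mollifierKernel (plateauMollifier d ((k : ℝ) + 2)) ℓ) =
      ∫ t in Ioo 0 T, ∫ x, kernelFlux (mollifierKernel (plateauMollifier d ((k : ℝ) + 2)) ℓ) (u t) x * ψ t x :=
    fun k => novackKernelPairing_eq_integral_kernelFlux hEq hdist hu3 hp
      (isSmooth_mollifierKernel (isUnitBallMollifier_plateauMollifier (hm1 k)).isMollifier hℓ)
      (mollifierKernel_neg (isUnitBallMollifier_plateauMollifier (hm1 k)).isMollifier ℓ) hψ
  exact tendsto_nhds_unique (hL.congr hev) hR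

/-- **Novack 2024, §2 Step 1, (eq:main:balance) with the ball kernel — proved.** The named fact
`Torus.novack2024_ballAvg_balance` holds: for `d ≥ 2`, `(u, p)` a weak Euler solution in Novack's
sense on `[0,T] × T^d` with `u ∈ L³ ∩ C⁰_t L²_x`, `p ∈ L^{3/2}`, `u₀ ∈ L²`, every scale
`0 < ℓ < 1/2` and every test function `ψ` supported in `(0,T) × T^d`,
`𝒩_ℓ(ψ) = −(d/ℓ) ∫₀ᵀ∫ ⨍_{S^{d−1}} (δu·ω)|δu|²(ℓω) dω ψ` (the reduction above and the tree's
discharge `Torus.symmTestField_identity_holds`, `DuchonRobertSymmTestFieldProofs`). [cite: Novack2024, Sect. 2 Step 1 (eq:main:balance) with γ = 0] -/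
theorem novack2024_ballAvg_balance_holds : novack2024_ballAvg_balance (d := d) :=
  novack2024_ballAvg_balance_of_symmTestField_identity fun {_} => symmTestField_identity_holds

end Assembly

end Literature.Analysis.FluidPDE.Torus
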